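import Literature.Probability.Percolation.MarkedLoopSpace
import Literature.Probability.Percolation.TriColourInterface
import Mathlib.RingTheory.RootsOfUnity.Complex
import HarnessLib

/-!
# Khristoforov–Smirnov's three-disorder parafermionic observable: Definition 3 and Lemma 4 for every 3-marked domain

Topic `Literature/Probability/Percolation`; lane pcv-sawmu (CriticalPhenomena), door D1. For a 3-marked discrete domain
`D : TriMarkedDomain 3` (Bollobás–Riordan 2006, Ch. 7 §7.2.2) — the hexagons `G = D.verts`, three marked boundary darts in
anticlockwise order with CORNER FACES `y₀, y₁, y₂` (the points of `∂Ω` where a two-colour boundary condition changes colour;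
Khristoforov–Smirnov's boundary disorders `u₁, u₂, u₃` up to the terminal half-edge) — and an `H_G`-edge `z` (a mid-edge of `Ω`):

* **Definition 3 (arXiv:2111.15612, §2 p. 4), loop form.** `W_Ω(u₁,u₂,u₃,z)` = loop configurations with disorders at the three
  corners and at `z`; in the tree's edge encoding a disorder at the mid-edge `z` of the `i`-th side of the face `v` is an edge set
  avoiding that side whose odd faces are the corners XOR the endpoint `s ∈ {v, oppFace v i}` carrying the half-edge
  (`MarkedLoops.loopSpaceX`, both halves counted); `classCount D v i j = #{ξ : z linked to y_j}` («the event `CP{z}{u_j}`»),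
  `Hobs D v i j = classCount / 2 ^ #G` (`= H_j(z) = P^loop[CP{z}{u_j}]`, uniform measure on the `2^{#Faces(Ω)}` configurations) and
  `Fobs D v i = Σ_{j : Fin 3} τ^j · Hobs D v i j` (`F(z) = Σ_j τ^j H_j(z)`, `τ = e^{2πi/3}`).
* **Lemma 4 (Discrete holomorphicity, p. 4).** «Let `z₁, z₂, z₃ ∈ MidEdgesExcept(Ω)` be three mid-edges around a vertex `v` indexed
  in the counterclockwise order, then `Σ_{k=1}^{3} τ^k F(z_k) = 0`.» Here: `khsLemma4_holds : KhSLemma4 D`, i.e. for every vertex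
  `v` of `H_G` with three `H_G`-sides (`AllSides D v` ⟺ at least two of its three hexagons in `Ω`), `Σ_{i : Fin 3} τ^i · Fobs D v i = 0`
  (sides indexed by `oppFace`, anticlockwise up to a cyclic shift), and `khsLemma4_ccw` in the `ccwNbr` indexing of the tree's
  five-point theorems. Boundary vertices of `Ω` with three mid-edges in `Ω` are included, exactly as printed.

Proof (the printed one): the triples are the completions of the CORES of `MarkedLoopCores.lean` (HT1); a core with one odd
neighbour, or with two odd neighbours linked to each other, completes into three configurations of the same class, weight
`(1 + τ + τ²) τ^j = 0` (HT2); a core with three pairwise unlinked odd neighbours links them to the three corners by a bijection `p`,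
and PLANARITY makes `p` an anticlockwise rotation (`ReLinking₃`), weight `Σ_i τ^i τ^{i+d} = τ^d (1 + τ² + τ⁴) = 0`. The chirality
is read off Bollobás–Riordan's oriented two-colour interface of the frame of `A₀` (`TriIface3.lean`: `A₀⁺` white, `A₁⁺ ∪ A₂⁺` black —
Khristoforov–Smirnov's reference colouring with reference corner `y₂`): deleting the strand to `y₂` and attaching the two other sides
of `v` gives an edge set with odd faces `{y₀, y₁}`, which is the bicoloured-side set of a colouring of `G` (`xiOf₃_surj`: injectivity
by flood fill + the parity computation `odd_xiDeg_xiOf₃_iff` + the `2 ^ #G` count); the deleted strand is black, so the interface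
passes `v` entering from `oppFace v (k₂+2)` and leaving towards `oppFace v (k₂+1)`, and the walk of exits from `v` ends at a corner
that is terminal for the walk, hence at `y₀` (`hc3K_next`).

Status in print: Definition 3 / Lemma 4 are PRINTED (Khristoforov–Smirnov 2021; the relation is Smirnov 2001's, Remark 6); this
file is their first kernel text, in the loop form and at the printed vertex-generality, next to the lane's NEW five-disorder
identities (`FivePointNormalisation/Holomorphy/HolomorphyBdry.lean`). Generality: Bollobás–Riordan marked domains (marks at sites
with two consecutive outer neighbours, `mark_pred`); the three disorders sit at the corner faces.

## References
* M. Khristoforov, S. Smirnov, *Percolation and O(1) loop model*, arXiv:2111.15612 (2021), §1.2 Lemma 2 (p. 3), §2 Definition 3,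
  Lemma 4, Remark 6 (pp. 4–5).
* S. Smirnov, *Critical percolation in the plane*, C. R. Acad. Sci. Paris Sér. I Math. 333 (2001) 239–244.
* B. Bollobás, O. Riordan, *Percolation*, Cambridge University Press (2006), Ch. 7 §7.2.2–7.2.3 pp. 168–179 (Lemma 5, Claim 10).

This file also carries (Part «cores», generic in the number of marks `k`) the core-triple machinery of the proof — the XOR space
`loopSpaceX`, CORES `IsCoreb` and the CORE DECOMPOSITION (HT1: `hbK_compl_mem`, `hbK_exists_unique`), the classes «the strand
from `s` ends at the corner `y_j`» (`InClassX`, `ComplClassX`) and INVARIANT TRIPLES (HT2: `invariantTriplesX_holds`), the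
uniqueness of the class of a completion (`hbK_complClass_existsUnique`), the regrouping by cores (`hbK_regroup`), and the reduced
configuration of a re-linking core (`hcK_Lk_mem`, `hcK_p_injective`) — the text of `FivePointHolomorphyBdry.lean` Parts A–C and
`FivePointCoreTriples.lean` with `k` generic (verbatim proofs; the purely local helper lemmas are private here because their
five-mark namesakes are already in the tree).
-/

open Finset

namespace Literature.Probability.Percolation.MarkedLoops

open Literature.Probability.Percolation Literature.Probability.LatticeModels
open Literature.Probability.Percolation.FivePoint (Inc inc_mk_iff side inc_side side_injective xiDeg XiLinked oppFace_injective' tau ccwNbr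
  hexFaceVertices_eq_triple)
open Literature.Probability.Percolation.FivePoint.N5 (sideGraph side_oppFace_oppIdx xiLinked_iff_reachable xorDeg_holds l1_xiDeg_eq
  l1_odd_xiDeg_singleton_iff h1_ne_oppFace h1_union_sides_eq_symmDiff coreCompl coreEnd coreOf oddSetOf ha_coreEnd_eq_or
  ht2_sideGraph_mono ht2_union_eq_symmDiff ht2_xiDeg_image_v ht2_not_iff_of_not ht3zk ht3Lk ht3_zk_subset ht3_mem_zk
  ht3_pair_eq_side ha_ccwNbr_eq_oppFace xiDeg_erase_side xiDeg_erase_of_forall_ne)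
open TriMarkedDomain

variable {nm : ℕ} (D : TriMarkedDomain nm)

/-! # Part «cores» (generic `k`) -/

/-! ## Part III — cores at a vertex with three `H_G`-sides: parity algebra and the core decomposition HT1 (generic `k`)
(the boundary-vertex edition `FivePointHolomorphyBdry` Parts A0–A2, verbatim with `k` marks: a neighbour of `v` that is a corner face and odd-indexed is EVEN) -/

/-- parity profile: the odd touching faces of `A` are exactly the members of `U`. [cite: KhristoforovSmirnov2021, §1.2 (loop configurations, pp. 2–3)] -/
def ParityIs (A : Finset (Sym2 (Site 2))) (U : Finset HexVertex) : Prop :=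
  ∀ F ∈ triFacesTouching D.verts, (Odd (xiDeg A F) ↔ F ∈ U)

open Classical in
/-- edge sets of `H_G` avoiding the three sides of the face `v`. [cite: KhristoforovSmirnov2021, §2 Lemma 4 (p. 4), proof and Fig. 3 (loop configurations grouped in triples at a vertex)] -/
noncomputable def Eminus (v : HexVertex) : Finset (Sym2 (Site 2)) :=
  (hBonds D).filter fun b => ∀ j : Fin 3, b ≠ side v j

/-- corner faces, as the finset `corners D`. [cite: KhristoforovSmirnov2021, §2 Lemma 4 (p. 4), proof and Fig. 3 (loop configurations grouped in triples at a vertex)] -/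
theorem h1_mem_corners_iff (F : HexVertex) : (∃ j : Fin nm, IsCornerFace D j F) ↔ F ∈ corners D := by
  rw [mem_corners]
  constructor
  · rintro ⟨j, hj⟩; exact ⟨j, (isCornerFace_iff_eq_yc D).1 hj⟩
  · rintro ⟨j, hj⟩; exact ⟨j, (isCornerFace_iff_eq_yc D).2 hj⟩

/-- the touching faces incident to the side `side W j` of an `H_G`-bond are `W` and `oppFace W j`. [cite: BollobasRiordan2006, Ch. 7 §7.2.2 pp. 168–171] -/
private theorem l3K_inc_side_iff {W F : HexVertex} {j : Fin 3} (hb : side W j ∈ hBonds D) (hF : F ∈ triFacesTouching D.verts) :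
    Inc F (side W j) ↔ (F = W ∨ F = oppFace W j) := by
  have hWt : W ∈ triFacesTouching D.verts := mem_touching_of_side_mem D hb
  have hOt : oppFace W j ∈ triFacesTouching D.verts := by
    have hb' : side (oppFace W j) (oppIdx W j) ∈ hBonds D := by rw [side_oppFace_oppIdx]; exact hb
    exact mem_touching_of_side_mem D hb'
  have hne : W ≠ oppFace W j := (hexGraph_adj_oppFace W j).ne
  have iW : Inc W (side W j) := inc_side W j
  have iO : Inc (oppFace W j) (side W j) := by rw [← side_oppFace_oppIdx]; exact inc_side _ _
  constructor
  · intro hi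
    exact eq_or_eq_of_inc_three D hb hWt hOt hF iW iO hi hne
  · rintro (rfl | rfl)
    · exact iW
    · exact iO

/-- a face has `side W j` among its sides iff it is incident to it (for an `H_G`-bond and a touching face). [cite: BollobasRiordan2006, Ch. 7 §7.2.2 pp. 168–171] -/
private theorem l3K_exists_side_eq_iff {W F : HexVertex} {j : Fin 3} (hb : side W j ∈ hBonds D) (hF : F ∈ triFacesTouching D.verts) :
    (∃ i : Fin 3, side F i = side W j) ↔ (F = W ∨ F = oppFace W j) := by
  rw [← l3K_inc_side_iff D hb hF]
  constructor
  · rintro ⟨i, hi⟩; rw [← hi]; exact inc_side F i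
  · intro hi
    obtain ⟨i, hi⟩ := exists_side_eq_of_inc D hb hi
    exact ⟨i, hi.symm⟩


/-- the sides of a face with all vertices in `G` are bonds of `H_G`. [cite: KhristoforovSmirnov2021, §2 Lemma 4 (p. 4), proof and Fig. 3 (loop configurations grouped in triples at a vertex)] -/
private theorem h1K_side_mem_hBonds {v : HexVertex} (hv : hexFaceVertices v ⊆ D.verts) (i : Fin 3) : side v i ∈ hBonds D := by
  have h := TriMarkedDomain.adj_faceVertex_succ v (i + 1)
  rw [add_assoc] at h
  exact mem_hBonds D h (Or.inl (hv (faceVertex_mem v _)))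

/-- all three sides of the face `v` are bonds of `H_G` (⟺ at least two of the three sites of `v` lie in `G`): Khristoforov–Smirnov's hypothesis «the three mid-edges at `v` are mid-edges of `Ω`». [cite: KhristoforovSmirnov2021, §2 Lemma 4 (p. 4)] -/
def AllSides (v : HexVertex) : Prop := ∀ i : Fin 3, side v i ∈ hBonds D

open Classical in
/-- **the XOR space `W_Ω(corners Δ {s})` at the bond `s(u, v)`** (dual to an `H_G`-edge `{x, x'}`), odd endpoint `s ∈ {x, x'}`: edge sets of `H_G` avoiding `s(u, v)` whose odd touching faces are the corner faces XOR `s`. For `k = 3` this is Khristoforov–Smirnov's `W_Ω(u₁,u₂,u₃,z)` on the subdivided edge, split by which half-edge at `z` is used. [cite: KhristoforovSmirnov2021, §1.2 (loop configurations, pp. 2–3)] -/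
noncomputable def loopSpaceX (u w : Site 2) (s : HexVertex) : Finset (Finset (Sym2 (Site 2))) :=
  ((hBonds D).erase s(u, w)).powerset.filter fun ξ =>
    ∀ F ∈ triFacesTouching D.verts, (Odd (xiDeg ξ F) ↔ Xor (∃ j : Fin nm, IsCornerFace D j F) (F = s))

open Classical in
/-- membership in `loopSpaceX`, unfolded. [cite: KhristoforovSmirnov2021, §1.2 (loop configurations, pp. 2–3)] -/
theorem mem_loopSpaceX (u w : Site 2) (s : HexVertex) (ξ : Finset (Sym2 (Site 2))) :
    ξ ∈ loopSpaceX D u w s ↔ ξ ⊆ (hBonds D).erase s(u, w) ∧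
      ∀ F ∈ triFacesTouching D.verts, (Odd (xiDeg ξ F) ↔ Xor (∃ j : Fin nm, IsCornerFace D j F) (F = s)) := by
  unfold loopSpaceX
  rw [Finset.mem_filter, Finset.mem_powerset]

/-- the XOR space at the `i`-th edge of `v` with odd endpoint `s` (`loopSpaceX` for the bond `side v i`). [cite: KhristoforovSmirnov2021, §1.2 (loop configurations, pp. 2–3)] -/
noncomputable def TXb (v : HexVertex) (i : Fin 3) (s : HexVertex) : Finset (Finset (Sym2 (Site 2))) :=
  loopSpaceX D (faceVertex v (i + 1)) (faceVertex v (i + 2)) s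

/-- a CORE at `v` with odd-neighbour index set `S` (`|S|` odd): an edge set avoiding the sides of `v` whose odd touching faces are the corners XOR the neighbours `oppFace v i`, `i ∈ S`. [cite: KhristoforovSmirnov2021, §2 Lemma 4 (p. 4), proof and Fig. 3 (loop configurations grouped in triples at a vertex)] -/
def IsCoreb (v : HexVertex) (S : Finset (Fin 3)) (ζ : Finset (Sym2 (Site 2))) : Prop :=
  ζ ⊆ Eminus D v ∧ Odd S.card ∧ ParityIs D ζ (symmDiff (corners D) (S.image (oppFace v)))

open Classical in
/-- the cores at `v`, as a finset of pairs `(S, ζ)`. [cite: KhristoforovSmirnov2021, §2 Lemma 4 (p. 4), proof and Fig. 3 (loop configurations grouped in triples at a vertex)] -/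
noncomputable def coreSetb (v : HexVertex) : Finset (Finset (Fin 3) × Finset (Sym2 (Site 2))) :=
  ((Finset.univ : Finset (Finset (Fin 3))) ×ˢ (Eminus D v).powerset).filter fun q => IsCoreb D v q.1 q.2

variable {D}

/-- two of the three sites in `G` give all sides in `H_G`. [cite: KhristoforovSmirnov2021, §2 Lemma 4 (p. 4)] -/
private theorem allSides_of_two_le {v : HexVertex} (h : 2 ≤ #((hexFaceVertices v).filter (· ∈ D.verts))) : AllSides D v := by
  classical
  intro i
  by_contra hnot
  have h1 : faceVertex v (i + 1) ∉ D.verts := fun hm =>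
    hnot (mem_hBonds D (by have := adj_faceVertex_succ v (i + 1); rwa [add_assoc] at this) (Or.inl hm))
  have h2 : faceVertex v (i + 2) ∉ D.verts := fun hm =>
    hnot (mem_hBonds D (by have := adj_faceVertex_succ v (i + 1); rwa [add_assoc] at this) (Or.inr hm))
  have hsub : (hexFaceVertices v).filter (· ∈ D.verts) ⊆ {faceVertex v i} := by
    intro x hx
    rw [Finset.mem_filter, hexFaceVertices_eq_triple v i] at hx
    rw [Finset.mem_singleton]
    rcases Finset.mem_insert.1 hx.1 with e | e
    · exact e
    rcases Finset.mem_insert.1 e with e | e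
    · exact absurd (e ▸ hx.2) h1
    · rw [Finset.mem_singleton] at e; exact absurd (e ▸ hx.2) h2
  have := (Finset.card_le_card hsub).trans (Finset.card_singleton _).le
  omega

/-- an interior face has all sides in `H_G`. [cite: KhristoforovSmirnov2021, §2 Lemma 4 (p. 4)] -/
theorem allSides_of_subset {v : HexVertex} (hv : hexFaceVertices v ⊆ D.verts) : AllSides D v :=
  fun i => h1K_side_mem_hBonds D hv i

section Facts

variable {v : HexVertex} (hv : AllSides D v)
include hv

/-- the face touches `G`. [cite: KhristoforovSmirnov2021, §2 Lemma 4 (p. 4)] -/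
private theorem hbK_v_touching : v ∈ triFacesTouching D.verts := mem_touching_of_side_mem D (hv 0)

/-- the neighbours touch `G`. [cite: KhristoforovSmirnov2021, §2 Lemma 4 (p. 4)] -/
private theorem hbK_opp_touching (i : Fin 3) : oppFace v i ∈ triFacesTouching D.verts := by
  have h := hv i
  rw [← side_oppFace_oppIdx v i] at h
  exact mem_touching_of_side_mem D h

/-- the face is not a corner face (corner faces have a side off `H_G`). [cite: BollobasRiordan2006, Ch. 7 §7.2.2 pp. 168–171] -/
private theorem hbK_v_not_corner : v ∉ corners D := by
  intro hc
  obtain ⟨i, hi⟩ := (mem_corners D).1 hc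
  obtain ⟨j, hj⟩ := exists_side_not_mem_hBonds_of_corner D ((isCornerFace_iff_eq_yc D).2 hi)
  exact hj (hv j)

/-- no corner is the face. [cite: BollobasRiordan2006, Ch. 7 §7.2.2 pp. 168–171] -/
theorem hbK_yc_ne_v (a : Fin nm) : yc D a ≠ v := fun e => hbK_v_not_corner hv (e ▸ (mem_corners D).2 ⟨a, rfl⟩)

/-- one endpoint of each side lies in `G`. [cite: KhristoforovSmirnov2021, §2 Lemma 4 (p. 4)] -/
private theorem hbK_exists_mem (i : Fin 3) :
    (faceVertex v (i + 1) ∈ D.verts) ∨ (faceVertex v (i + 2) ∈ D.verts) := by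
  obtain ⟨a, b, he, ha, -⟩ := exists_rep_of_mem_hBonds D (hv i)
  unfold side at he
  rcases Sym2.eq_iff.1 he with ⟨h1, -⟩ | ⟨-, h2⟩
  · exact Or.inl (h1 ▸ ha)
  · exact Or.inr (h2 ▸ ha)

end Facts

open Classical in
/-- **parity of a set of sides of `v`** (the tree's `h1_odd_xiDeg_sides` under `AllSides`). [cite: KhristoforovSmirnov2021, §2 Lemma 4 (p. 4), proof and Fig. 3 (loop configurations grouped in triples at a vertex)] -/
private theorem hbK_odd_xiDeg_sides {v : HexVertex} (hv : AllSides D v) (I : Finset (Fin 3)) {F : HexVertex}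
    (hF : F ∈ triFacesTouching D.verts) :
    Odd (xiDeg (I.image (side v)) F) ↔ ((F = v ∧ Odd I.card) ∨ ∃ i ∈ I, F = oppFace v i) := by
  induction I using Finset.induction_on with
  | empty =>
    have h0 : xiDeg ((∅ : Finset (Fin 3)).image (side v)) F = 0 := by
      rw [Finset.image_empty, l1_xiDeg_eq, Finset.card_eq_zero, Finset.filter_eq_empty_iff]
      intro j _ hj; exact absurd hj (Finset.notMem_empty _)
    rw [h0]
    simp
  | insert i I hi ih =>
    have hnot : side v i ∉ I.image (side v) := by
      rw [Finset.mem_image]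
      rintro ⟨i', hi', he⟩
      exact hi (side_injective v he ▸ hi')
    have hsd : (insert i I).image (side v) = symmDiff {side v i} (I.image (side v)) := by
      rw [Finset.image_insert]
      ext b
      rw [Finset.mem_insert, Finset.mem_symmDiff, Finset.mem_singleton]
      constructor
      · rintro (rfl | h)
        · exact Or.inl ⟨rfl, hnot⟩
        · exact Or.inr ⟨h, fun e => hnot (e ▸ h)⟩
      · rintro (⟨rfl, -⟩ | ⟨h, -⟩)
        · exact Or.inl rfl
        · exact Or.inr h
    rw [hsd, xorDeg_holds, l1_odd_xiDeg_singleton_iff, l3K_exists_side_eq_iff D (hv i) hF, ih,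
      Finset.card_insert_of_notMem hi, Nat.odd_add_one, Finset.exists_mem_insert]
    have hne : v ≠ oppFace v i := h1_ne_oppFace v i
    have hnoI : ¬ ∃ i' ∈ I, oppFace v i = oppFace v i' := by
      rintro ⟨i', hi', he⟩; exact hi (oppFace_injective' v he ▸ hi')
    have hnov : ¬ ∃ i' ∈ I, v = oppFace v i' := by
      rintro ⟨i', -, he⟩; exact h1_ne_oppFace v i' he
    by_cases hFv : F = v
    · rw [hFv]
      simp [hne, hnov]
    · by_cases hFi : F = oppFace v i
      · rw [hFi]
        simp [hne.symm, hnoI]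
      · simp [hFv, hFi]

/-- XOR of membership is membership in the symmetric difference. [folklore] -/
private theorem mem_symmDiff_iff_not_iff {α : Type*} [DecidableEq α] (s t : Finset α) (a : α) :
    a ∈ symmDiff s t ↔ ¬ (a ∈ s ↔ a ∈ t) := by
  rw [Finset.mem_symmDiff]; tauto

/-- `Xor` with the corner predicate is membership in `corners Δ {s}`. [cite: KhristoforovSmirnov2021, §1.2 (loop configurations, pp. 2–3)] -/
theorem xor_corner_iff_mem_symmDiff (s F : HexVertex) :
    Xor (∃ j : Fin nm, IsCornerFace D j F) (F = s) ↔ F ∈ symmDiff (corners D) ({s} : Finset HexVertex) := by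
  classical
  rw [h1_mem_corners_iff, Finset.mem_symmDiff, Finset.mem_singleton]
  rfl

/-- the three-way XOR bookkeeping behind HT1. [folklore] -/
private theorem prop_par₁ {c si pr es : Prop} (h : Xor si pr ↔ es) : (¬ (¬ (c ↔ si) ↔ pr)) ↔ ¬ (c ↔ es) := by
  unfold Xor at *; tauto

/-- … and its inverse reading. [folklore] -/
private theorem prop_par₂ {c si pr es : Prop} (h : Xor si pr ↔ es) : (¬ (¬ (c ↔ es) ↔ pr)) ↔ ¬ (c ↔ si) := by
  unfold Xor at *; tauto

/-- **the key XOR at `v`**: for `S` odd, «`F` is an odd neighbour» XOR «`F` is odd for the sides `S ∖ {k}`» iff `F` is the odd endpoint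
`coreEnd v S k`. [cite: KhristoforovSmirnov2021, §2 Lemma 4 (p. 4), proof and Fig. 3 (loop configurations grouped in triples at a vertex)] -/
private theorem hbK_xor_key (v : HexVertex) {S : Finset (Fin 3)} (hodd : Odd S.card) (k : Fin 3) (F : HexVertex) :
    Xor (∃ i ∈ S, F = oppFace v i) ((F = v ∧ Odd (S.erase k).card) ∨ ∃ i ∈ S.erase k, F = oppFace v i) ↔ F = coreEnd v S k := by
  classical
  have hvo : ∀ i : Fin 3, v ≠ oppFace v i := h1_ne_oppFace v
  have hcard : Odd (S.erase k).card ↔ k ∉ S := by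
    by_cases hk : k ∈ S
    · rw [Finset.card_erase_of_mem hk]
      obtain ⟨m, hm⟩ := hodd
      rw [hm, Nat.add_sub_cancel]
      exact ⟨fun ho => absurd ho (by rw [Nat.odd_iff]; omega), fun h => absurd hk h⟩
    · rw [Finset.erase_eq_of_notMem hk]; exact ⟨fun _ => hk, fun _ => hodd⟩
  unfold coreEnd Xor
  by_cases hFv : F = v
  · subst hFv
    have hno : ¬ ∃ i ∈ S, F = oppFace F i := fun ⟨i, _, e⟩ => hvo i e
    have hno' : ¬ ∃ i ∈ S.erase k, F = oppFace F i := fun ⟨i, _, e⟩ => hvo i e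
    simp only [hno, hno', or_false, true_and, hcard, false_and, not_false_eq_true, and_true, false_or]
    split_ifs with h
    · exact ⟨fun h' => absurd h h', fun e => absurd e (hvo k)⟩
    · exact ⟨fun _ => rfl, fun _ => h⟩
  · by_cases hFo : ∃ i : Fin 3, F = oppFace v i
    · obtain ⟨i, rfl⟩ := hFo
      have him : (∃ i' ∈ S, oppFace v i = oppFace v i') ↔ i ∈ S := by
        constructor
        · rintro ⟨i', hi', e⟩; exact oppFace_injective' v e ▸ hi'
        · intro h; exact ⟨i, h, rfl⟩
      have hex : (∃ i' ∈ S.erase k, oppFace v i = oppFace v i') ↔ (i ≠ k ∧ i ∈ S) := by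
        constructor
        · rintro ⟨i', hi', e⟩
          have := oppFace_injective' v e; subst this
          exact Finset.mem_erase.1 hi'
        · intro h; exact ⟨i, Finset.mem_erase.2 h, rfl⟩
      simp only [him, hFv, false_and, hex, false_or]
      split_ifs with h
      · constructor
        · rintro (⟨hi, hn⟩ | ⟨⟨hik, hi⟩, hn⟩)
          · by_cases hik : i = k
            · rw [hik]
            · exact absurd ⟨hik, hi⟩ hn
          · exact absurd hi hn
        · intro e
          have := oppFace_injective' v e; subst this
          exact Or.inl ⟨h, fun h' => h'.1 rfl⟩
      · constructor
        · rintro (⟨hi, hn⟩ | ⟨⟨hik, hi⟩, hn⟩)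
          · by_cases hik : i = k
            · subst hik; exact absurd hi h
            · exact absurd ⟨hik, hi⟩ hn
          · exact absurd hi hn
        · intro e; exact absurd e.symm (hvo i)
    · have hFo' : ∀ i, F ≠ oppFace v i := fun i e => hFo ⟨i, e⟩
      have hno : ¬ ∃ i ∈ S, F = oppFace v i := fun ⟨i, _, e⟩ => hFo' i e
      have hno' : ¬ ∃ i ∈ S.erase k, F = oppFace v i := fun ⟨i, _, e⟩ => hFo' i e
      simp only [hno, hno', hFv, false_and, or_false, not_false_eq_true, and_true, false_iff]
      split_ifs with h
      · exact hFo' k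
      · exact hFv


/-- membership in `TXb`, as support + parity profile `corners Δ {s}`. [cite: KhristoforovSmirnov2021, §1.2 (loop configurations, pp. 2–3)] -/
theorem mem_TXb_iff (v : HexVertex) (i : Fin 3) (s : HexVertex) (A : Finset (Sym2 (Site 2))) :
    A ∈ TXb D v i s ↔ A ⊆ (hBonds D).erase (side v i) ∧ ParityIs D A (symmDiff (corners D) {s}) := by
  unfold TXb
  rw [mem_loopSpaceX]
  unfold ParityIs side
  refine and_congr Iff.rfl (forall₂_congr fun F _ => ?_)
  rw [xor_corner_iff_mem_symmDiff]

/-- the boundary cores avoid the sides of `v` and lie in `H_G`. [cite: KhristoforovSmirnov2021, §2 Lemma 4 (p. 4), proof and Fig. 3 (loop configurations grouped in triples at a vertex)] -/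
private theorem hbK_core_sub {v : HexVertex} {S : Finset (Fin 3)} {ζ : Finset (Sym2 (Site 2))} (hq : IsCoreb D v S ζ) :
    ζ ⊆ hBonds D ∧ ∀ j : Fin 3, side v j ∉ ζ := by
  classical
  have hsub := hq.1
  unfold Eminus at hsub
  refine ⟨fun b hb => (Finset.mem_filter.1 (hsub hb)).1, fun j hj => ?_⟩
  exact (Finset.mem_filter.1 (hsub hj)).2 j rfl

open Classical in
/-- **HT1∂, first half**: the completion of a boundary core at `k` lies in `TXb` at the `k`-th edge with odd endpoint `coreEnd`. [cite: KhristoforovSmirnov2021, §2 Lemma 4 (p. 4), proof and Fig. 3 (loop configurations grouped in triples at a vertex)] -/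
theorem hbK_compl_mem {v : HexVertex} (hv : AllSides D v) (k : Fin 3) (S : Finset (Fin 3))
    (ζ : Finset (Sym2 (Site 2))) (hq : IsCoreb D v S ζ) : coreCompl v S k ζ ∈ TXb D v k (coreEnd v S k) := by
  obtain ⟨hζh, hside⟩ := hbK_core_sub hq
  have hodd := hq.2.1
  have hpar := hq.2.2
  rw [mem_TXb_iff]
  unfold coreCompl
  refine ⟨?_, fun F hF => ?_⟩
  · intro b hb
    rw [Finset.mem_erase]
    rcases Finset.mem_union.1 hb with h | h
    · exact ⟨fun e => hside k (e ▸ h), hζh h⟩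
    · obtain ⟨i, hi, rfl⟩ := Finset.mem_image.1 h
      exact ⟨fun e => (Finset.mem_erase.1 hi).1 (side_injective v e), hv i⟩
  · rw [h1_union_sides_eq_symmDiff hside, xorDeg_holds, hpar F hF, hbK_odd_xiDeg_sides hv (S.erase k) hF,
      mem_symmDiff_iff_not_iff, mem_symmDiff_iff_not_iff, Finset.mem_singleton]
    have him : F ∈ S.image (oppFace v) ↔ ∃ i ∈ S, F = oppFace v i := by
      rw [Finset.mem_image]
      constructor
      · rintro ⟨i, hi, e⟩; exact ⟨i, hi, e.symm⟩
      · rintro ⟨i, hi, e⟩; exact ⟨i, hi, e.symm⟩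
    rw [him]
    exact prop_par₁ (hbK_xor_key v hodd k F)

open Classical in
/-- **HT1∂, second half**: every configuration of `TXb` at the `k`-th edge has exactly one boundary-core preimage. [cite: KhristoforovSmirnov2021, §2 Lemma 4 (p. 4), proof and Fig. 3 (loop configurations grouped in triples at a vertex)] -/
theorem hbK_exists_unique {v : HexVertex} (hv : AllSides D v) (k : Fin 3) {s : HexVertex}
    (hs : s ∈ ({v, oppFace v k} : Finset HexVertex)) {ξ : Finset (Sym2 (Site 2))} (hξ : ξ ∈ TXb D v k s) :
    ∃! p : Finset (Fin 3) × Finset (Sym2 (Site 2)), IsCoreb D v p.1 p.2 ∧ coreEnd v p.1 k = s ∧ coreCompl v p.1 k p.2 = ξ := by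
  have hξ' := hξ
  rw [mem_TXb_iff] at hξ'
  obtain ⟨hsub, hparξ⟩ := hξ'
  have hξh : ξ ⊆ hBonds D := fun b hb => Finset.mem_of_mem_erase (hsub hb)
  have hk : side v k ∉ ξ := fun h => (Finset.mem_erase.1 (hsub h)).1 rfl
  rw [Finset.mem_insert, Finset.mem_singleton] at hs
  have hvo : ∀ i : Fin 3, v ≠ oppFace v i := h1_ne_oppFace v
  have hvc := hbK_v_not_corner hv
  have hvt := hbK_v_touching hv
  obtain ⟨R, hR⟩ : ∃ R : Finset (Fin 3), R = Finset.univ.filter fun i => side v i ∈ ξ := ⟨_, rfl⟩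
  obtain ⟨ζ, hζ⟩ : ∃ ζ : Finset (Sym2 (Site 2)), ζ = coreOf v ξ := ⟨_, rfl⟩
  obtain ⟨S, hS⟩ : ∃ S : Finset (Fin 3), S = oddSetOf v k s ξ := ⟨_, rfl⟩
  have hRmem : ∀ i : Fin 3, i ∈ R ↔ side v i ∈ ξ := fun i => by rw [hR, Finset.mem_filter]; simp
  have hζmem : ∀ b, b ∈ ζ ↔ b ∈ ξ ∧ ∀ j : Fin 3, b ≠ side v j := fun b => by rw [hζ]; unfold coreOf; rw [Finset.mem_filter]
  have hζside : ∀ j : Fin 3, side v j ∉ ζ := fun j h => ((hζmem _).1 h).2 j rfl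
  have hζsub : ζ ⊆ ξ := fun b hb => ((hζmem b).1 hb).1
  have hdec : ξ = ζ ∪ R.image (side v) := by
    ext b
    rw [Finset.mem_union, hζmem, Finset.mem_image]
    constructor
    · intro hb
      by_cases h : ∀ j : Fin 3, b ≠ side v j
      · exact Or.inl ⟨hb, h⟩
      · push Not at h
        obtain ⟨j, rfl⟩ := h
        exact Or.inr ⟨j, (hRmem j).2 hb, rfl⟩
    · rintro (⟨hb, -⟩ | ⟨j, hj, rfl⟩)
      · exact hb
      · exact (hRmem j).1 hj
  have hsd : ξ = symmDiff ζ (R.image (side v)) := by rw [← h1_union_sides_eq_symmDiff hζside]; exact hdec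
  -- parity of `R`: odd iff `s = v`
  have hRodd : Odd R.card ↔ s = v := by
    have h := hparξ v hvt
    rw [l1_xiDeg_eq, mem_symmDiff_iff_not_iff, Finset.mem_singleton] at h
    rw [hR, h]
    constructor
    · intro h'; by_contra hsv; exact h' ⟨fun hc => absurd hc hvc, fun e => absurd e.symm hsv⟩
    · intro e h'; exact hvc (h'.2 e.symm)
  have hSk : k ∈ S ↔ s = oppFace v k := by
    rw [hS]; unfold oddSetOf; rw [Finset.mem_filter]; simp
  have hSi : ∀ i : Fin 3, i ≠ k → (i ∈ S ↔ side v i ∈ ξ) := by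
    intro i hik; rw [hS]; unfold oddSetOf; rw [Finset.mem_filter]; simp [hik]
  have hSerase : S.erase k = R := by
    ext i
    rw [Finset.mem_erase, hRmem]
    constructor
    · rintro ⟨hik, hi⟩; exact (hSi i hik).1 hi
    · intro hi
      have hik : i ≠ k := fun e => hk (e ▸ hi)
      exact ⟨hik, (hSi i hik).2 hi⟩
  have hScard : Odd S.card := by
    by_cases hsk : s = oppFace v k
    · have hkS : k ∈ S := hSk.2 hsk
      have : S.card = R.card + 1 := by rw [← Finset.card_erase_add_one hkS, hSerase]
      rw [this, Nat.odd_add_one, hRodd]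
      intro e; exact hvo k (e.symm.trans hsk)
    · have hkS : k ∉ S := fun h => hsk (hSk.1 h)
      have : S = R := by rw [← Finset.erase_eq_of_notMem hkS, hSerase]
      rw [this, hRodd]
      exact hs.resolve_right hsk
  have hend : coreEnd v S k = s := by
    unfold coreEnd
    split_ifs with h
    · exact (hSk.1 h).symm
    · exact (hs.resolve_right fun e => h (hSk.2 e)).symm
  -- the core property
  have hcore : IsCoreb D v S ζ := by
    refine ⟨?_, hScard, fun F hF => ?_⟩
    · intro b hb
      unfold Eminus
      rw [Finset.mem_filter]
      exact ⟨hξh (hζsub hb), ((hζmem b).1 hb).2⟩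
    · have hx := xorDeg_holds ξ (R.image (side v)) F
      have hζeq : ζ = symmDiff ξ (R.image (side v)) := by
        rw [hsd, symmDiff_assoc, symmDiff_self, symmDiff_bot]
      rw [← hζeq] at hx
      rw [hx, hparξ F hF, hbK_odd_xiDeg_sides hv R hF, mem_symmDiff_iff_not_iff, mem_symmDiff_iff_not_iff,
        Finset.mem_singleton, ← hSerase, ← hend]
      have him : F ∈ S.image (oppFace v) ↔ ∃ i ∈ S, F = oppFace v i := by
        rw [Finset.mem_image]
        constructor
        · rintro ⟨i, hi, e⟩; exact ⟨i, hi, e.symm⟩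
        · rintro ⟨i, hi, e⟩; exact ⟨i, hi, e.symm⟩
      rw [him]
      exact prop_par₂ (hbK_xor_key v hScard k F)
  have hcompl : coreCompl v S k ζ = ξ := by
    unfold coreCompl
    rw [hSerase, ← hdec]
  refine ⟨(S, ζ), ⟨hcore, hend, hcompl⟩, ?_⟩
  rintro ⟨S', ζ'⟩ ⟨hcore', hend', hcompl'⟩
  obtain ⟨-, hside'⟩ := hbK_core_sub hcore'
  have hζ' : ζ' = ζ := by
    ext b
    rw [hζmem]
    constructor
    · intro hb
      refine ⟨?_, fun j e => hside' j (e ▸ hb)⟩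
      rw [← hcompl']; unfold coreCompl; exact Finset.mem_union_left _ hb
    · rintro ⟨hbξ, hbside⟩
      rw [← hcompl'] at hbξ
      unfold coreCompl at hbξ
      rcases Finset.mem_union.1 hbξ with h | h
      · exact h
      · obtain ⟨j, -, rfl⟩ := Finset.mem_image.1 h
        exact absurd rfl (hbside j)
  have hS' : S' = S := by
    ext i
    by_cases hik : i = k
    · subst hik
      rw [hSk]
      unfold coreEnd at hend'
      split_ifs at hend' with h
      · exact ⟨fun _ => hend'.symm, fun _ => h⟩
      · exact ⟨fun h' => absurd h' h, fun e => absurd (hend'.trans e) (hvo i)⟩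
    · rw [hSi i hik]
      constructor
      · intro hi
        rw [← hcompl']; unfold coreCompl
        exact Finset.mem_union_right _ (Finset.mem_image.2 ⟨i, Finset.mem_erase.2 ⟨hik, hi⟩, rfl⟩)
      · intro hi
        rw [← hcompl'] at hi
        unfold coreCompl at hi
        rcases Finset.mem_union.1 hi with h | h
        · exact absurd h (hside' i)
        · obtain ⟨i', hi', e⟩ := Finset.mem_image.1 h
          have := side_injective v e; subst this
          exact (Finset.mem_erase.1 hi').2
  simp only [Prod.mk.injEq]
  exact ⟨hS', hζ'⟩


open Classical in
/-- membership in `coreSetb`. [cite: KhristoforovSmirnov2021, §2 Lemma 4 (p. 4), proof and Fig. 3 (loop configurations grouped in triples at a vertex)] -/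
private theorem hbK_mem_coreSetb {v : HexVertex} {q : Finset (Fin 3) × Finset (Sym2 (Site 2))} :
    q ∈ coreSetb D v ↔ IsCoreb D v q.1 q.2 := by
  unfold coreSetb
  rw [Finset.mem_filter, Finset.mem_product, Finset.mem_powerset]
  constructor
  · exact fun h => h.2
  · intro h; exact ⟨⟨Finset.mem_univ _, h.1⟩, h⟩


/-! ## Part IV — classes «the strand from `s` ends at the corner `y_j`», HT2 (invariant triples) and corner partners (generic `k`)
(`FivePointHolomorphyBdry` Part B without the matching component of the five-point classes) -/

variable (D) in
/-- the CLASS «`z` is linked to `u_j`» of the XOR space at the bond `s(u, w)` with odd endpoint `s`: the strand from `s` ends at the corner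
face `y_j` (Khristoforov–Smirnov's event `CP{z}{u_j}`, §2 p. 4). [cite: KhristoforovSmirnov2021, §2 Definition 3 (p. 4)] -/
def InClassX (u w : Site 2) (s : HexVertex) (j : Fin nm) (ξ : Finset (Sym2 (Site 2))) : Prop :=
  ξ ∈ loopSpaceX D u w s ∧ ∃ Y : HexVertex, IsCornerFace D j Y ∧ XiLinked ξ s Y

variable (D) in
/-- the class predicate of the completion at the `i`-th edge of `v` of the core `(S, ζ)`. [cite: KhristoforovSmirnov2021, §2 Lemma 4 (p. 4), proof and Fig. 3 (loop configurations grouped in triples at a vertex)] -/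
def ComplClassX (v : HexVertex) (S : Finset (Fin 3)) (i : Fin 3) (ζ : Finset (Sym2 (Site 2))) (j : Fin nm) : Prop :=
  InClassX D (faceVertex v (i + 1)) (faceVertex v (i + 2)) (coreEnd v S i) j (coreCompl v S i ζ)

/-- **HT2 (INVARIANT TRIPLES at a vertex with all sides in `H_G`)**: a core with one odd neighbour, or with two odd neighbours linked to
each other, completes at the three edges of `v` into configurations of the SAME class. [cite: KhristoforovSmirnov2021, §2 Lemma 4 (p. 4), proof and Fig. 3 (loop configurations grouped in triples at a vertex)] -/
def InvariantTriplesX (D : TriMarkedDomain nm) : Prop :=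
  ∀ v : HexVertex, AllSides D v → ∀ (S : Finset (Fin 3)) (ζ : Finset (Sym2 (Site 2))), IsCoreb D v S ζ →
    (S.card = 1 ∨ ∃ i ∈ S, ∃ i' ∈ S, i ≠ i' ∧ XiLinked ζ (oppFace v i) (oppFace v i')) →
      ∀ (i i' : Fin 3) (j : Fin nm), ComplClassX D v S i ζ j ↔ ComplClassX D v S i' ζ j

/-- `InClassX` unfolded: membership and the link of `s` to `y_j`. [cite: KhristoforovSmirnov2021, §1.2 (loop configurations, pp. 2–3)] -/
theorem hbK_inClassX_iff (u w : Site 2) (s : HexVertex) (j : Fin nm) (A : Finset (Sym2 (Site 2))) :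
    InClassX D u w s j A ↔ A ∈ loopSpaceX D u w s ∧ (sideGraph A).Reachable s (yc D j) := by
  unfold InClassX
  constructor
  · rintro ⟨h1, ⟨Y, hY, hl⟩⟩
    rw [eq_yc D hY] at hl
    exact ⟨h1, (xiLinked_iff_reachable _ _ _).1 hl⟩
  · rintro ⟨h1, hl⟩
    exact ⟨h1, ⟨yc D j, yc_spec D j, (xiLinked_iff_reachable _ _ _).2 hl⟩⟩

/-- at most two sides if one side is missing. [folklore] -/
private theorem hbK_card_filter_le_two_of_not {p : Fin 3 → Prop} [DecidablePred p] {j₀ : Fin 3} (h : ¬ p j₀) :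
    #((Finset.univ : Finset (Fin 3)).filter p) ≤ 2 := by
  have hsub : (Finset.univ : Finset (Fin 3)).filter p ⊆ Finset.univ.erase j₀ := by
    intro j hj
    rw [Finset.mem_erase]
    exact ⟨fun e => h (e ▸ (Finset.mem_filter.1 hj).2), Finset.mem_univ _⟩
  exact (Finset.card_le_card hsub).trans (by rw [Finset.card_erase_of_mem (Finset.mem_univ _)]; simp)

open Classical in
/-- **degrees in a boundary core are at most two.** [cite: KhristoforovSmirnov2021, §2 Lemma 4 (p. 4), proof and Fig. 3 (loop configurations grouped in triples at a vertex)] -/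
private theorem hbK_core_deg_le_two {v : HexVertex} {S : Finset (Fin 3)} {ζ : Finset (Sym2 (Site 2))} (hq : IsCoreb D v S ζ) (F : HexVertex) :
    xiDeg ζ F ≤ 2 := by
  obtain ⟨hζh, hside⟩ := hbK_core_sub hq
  have hpar := hq.2.2
  by_cases hF : F ∈ triFacesTouching D.verts
  · by_cases hodd : Odd (xiDeg ζ F)
    · have hmem := (hpar F hF).1 hodd
      rcases Finset.mem_symmDiff.1 hmem with ⟨hc, -⟩ | ⟨hx, -⟩
      · obtain ⟨i, hi⟩ := (mem_corners D).1 hc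
        obtain ⟨j₀, hj₀⟩ := exists_side_not_mem_hBonds_of_corner D ((isCornerFace_iff_eq_yc D).2 hi)
        exact hbK_card_filter_le_two_of_not (j₀ := j₀) fun h => hj₀ (hζh h)
      · obtain ⟨i, -, rfl⟩ := Finset.mem_image.1 hx
        refine hbK_card_filter_le_two_of_not (j₀ := oppIdx v i) fun h => ?_
        have h' : side (oppFace v i) (oppIdx v i) ∈ ζ := h
        rw [side_oppFace_oppIdx] at h'
        exact hside i h'
    · have h3 : xiDeg ζ F ≤ 3 := (Finset.card_filter_le _ _).trans (by simp)
      rcases Nat.even_or_odd (xiDeg ζ F) with ⟨k, hk⟩ | ho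
      · omega
      · exact absurd ho hodd
  · have : xiDeg ζ F = 0 := by
      unfold xiDeg
      rw [Finset.card_eq_zero, Finset.filter_eq_empty_iff]
      intro j _ hj
      exact hF (mem_touching_of_side_mem D (hζh hj))
    omega

open Classical in
/-- **corner partners** in a boundary core with all three neighbours odd-indexed and no two linked: each neighbour is linked to a
corner (a neighbour that is a corner face is its own partner). [cite: KhristoforovSmirnov2021, §2 Lemma 4 (p. 4), proof and Fig. 3 (loop configurations grouped in triples at a vertex)] -/
theorem hbK_core_partners {v : HexVertex} (hv : AllSides D v) {ζ : Finset (Sym2 (Site 2))} (hq : IsCoreb D v Finset.univ ζ)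
    (hnl : ∀ i i' : Fin 3, i ≠ i' → ¬ XiLinked ζ (oppFace v i) (oppFace v i')) (k : Fin 3) :
    ∃ i : Fin nm, XiLinked ζ (oppFace v k) (yc D i) := by
  obtain ⟨hζh, -⟩ := hbK_core_sub hq
  have hpar := hq.2.2
  by_cases hc : oppFace v k ∈ corners D
  · obtain ⟨i, hi⟩ := (mem_corners D).1 hc
    exact ⟨i, (xiLinked_iff_reachable _ _ _).2 (by rw [hi])⟩
  have hxt : oppFace v k ∈ triFacesTouching D.verts := hbK_opp_touching hv k
  have hxodd : Odd (xiDeg ζ (oppFace v k)) :=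
    (hpar _ hxt).2 (Finset.mem_symmDiff.2 (Or.inr ⟨Finset.mem_image.2 ⟨k, Finset.mem_univ _, rfl⟩, hc⟩))
  obtain ⟨⟨Y, hYne, hYodd, hreach⟩, -⟩ := odd_component D hζh (hbK_core_deg_le_two hq) hxt hxodd
  have hYt : Y ∈ triFacesTouching D.verts := by
    obtain ⟨w⟩ := hreach.symm
    cases w with
    | nil => exact absurd rfl hYne
    | cons hadj _ => exact sideGraph_adj_touching D hζh hadj
  have hYmem := (hpar Y hYt).1 hYodd
  rcases Finset.mem_symmDiff.1 hYmem with ⟨hcY, -⟩ | ⟨hx, -⟩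
  · obtain ⟨i, rfl⟩ := (mem_corners D).1 hcY
    exact ⟨i, (xiLinked_iff_reachable _ _ _).2 hreach⟩
  · obtain ⟨i, -, rfl⟩ := Finset.mem_image.1 hx
    have hik : k ≠ i := fun e => hYne (by rw [e])
    exact absurd ((xiLinked_iff_reachable _ _ _).2 hreach) (hnl k i hik)


/-- `v` is isolated in a boundary core. [cite: KhristoforovSmirnov2021, §2 Lemma 4 (p. 4), proof and Fig. 3 (loop configurations grouped in triples at a vertex)] -/
private theorem hbK_reach_v {v : HexVertex} {S : Finset (Fin 3)} {ζ : Finset (Sym2 (Site 2))} (hq : IsCoreb D v S ζ) {F : HexVertex}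
    (h : (sideGraph ζ).Reachable v F) : F = v := by
  rw [SimpleGraph.reachable_iff_reflTransGen] at h
  induction h with
  | refl => rfl
  | tail _ hbc ih =>
    subst ih
    obtain ⟨j, -, hj⟩ := hbc
    exact absurd hj ((hbK_core_sub hq).2 j)

/-- **a neighbour in `S` that is a corner face has no side in the core** (its only `H_G`-side other than `side v i` would make it odd,
but in `S` it is even). [cite: KhristoforovSmirnov2021, §2 Lemma 4 (p. 4), proof and Fig. 3 (loop configurations grouped in triples at a vertex)] -/
private theorem hbK_corner_nbr_deg_zero {v : HexVertex} (hv : AllSides D v) {S : Finset (Fin 3)} {ζ : Finset (Sym2 (Site 2))}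
    (hq : IsCoreb D v S ζ) {i : Fin 3} (hi : i ∈ S) (hc : oppFace v i ∈ corners D) : xiDeg ζ (oppFace v i) = 0 := by
  classical
  obtain ⟨hζh, hside⟩ := hbK_core_sub hq
  obtain ⟨a, ha⟩ := (mem_corners D).1 hc
  obtain ⟨j₀, hj₀⟩ := exists_side_not_mem_hBonds_of_corner D ((isCornerFace_iff_eq_yc D).2 ha)
  have heven : ¬ Odd (xiDeg ζ (oppFace v i)) := by
    rw [hq.2.2 _ (hbK_opp_touching hv i), Finset.mem_symmDiff]
    rintro (⟨-, h⟩ | ⟨-, h⟩)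
    · exact h (Finset.mem_image.2 ⟨i, hi, rfl⟩)
    · exact h hc
  have hle : xiDeg ζ (oppFace v i) ≤ 1 := by
    rw [l1_xiDeg_eq]
    have hsub : ((Finset.univ : Finset (Fin 3)).filter fun j => side (oppFace v i) j ∈ ζ) ⊆
        (Finset.univ.erase j₀).erase (oppIdx v i) := by
      intro j hj
      rw [Finset.mem_filter] at hj
      rw [Finset.mem_erase, Finset.mem_erase]
      refine ⟨fun e => ?_, fun e => hj₀ (e ▸ hζh hj.2), Finset.mem_univ _⟩
      rw [e, side_oppFace_oppIdx] at hj
      exact hside i hj.2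
    have hne : oppIdx v i ≠ j₀ := by
      intro e
      apply hj₀
      rw [← e, side_oppFace_oppIdx]
      exact hv i
    have hcard : #((Finset.univ.erase j₀).erase (oppIdx v i)) = 1 := by
      rw [Finset.card_erase_of_mem (Finset.mem_erase.2 ⟨hne, Finset.mem_univ _⟩),
        Finset.card_erase_of_mem (Finset.mem_univ _)]
      simp
    exact (Finset.card_le_card hsub).trans hcard.le
  rcases Nat.even_or_odd (xiDeg ζ (oppFace v i)) with ⟨m, hm⟩ | ho
  · omega
  · exact absurd ho heven

/-- … hence it is isolated in the core. [cite: KhristoforovSmirnov2021, §2 Lemma 4 (p. 4), proof and Fig. 3 (loop configurations grouped in triples at a vertex)] -/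
private theorem hbK_corner_nbr_reach {v : HexVertex} (hv : AllSides D v) {S : Finset (Fin 3)} {ζ : Finset (Sym2 (Site 2))}
    (hq : IsCoreb D v S ζ) {i : Fin 3} (hi : i ∈ S) (hc : oppFace v i ∈ corners D) {F : HexVertex}
    (h : (sideGraph ζ).Reachable (oppFace v i) F) : F = oppFace v i := by
  classical
  have h0 := hbK_corner_nbr_deg_zero hv hq hi hc
  rw [l1_xiDeg_eq, Finset.card_eq_zero, Finset.filter_eq_empty_iff] at h0
  rw [SimpleGraph.reachable_iff_reflTransGen] at h
  induction h with
  | refl => rfl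
  | tail _ hbc ih =>
    subst ih
    obtain ⟨j, -, hj⟩ := hbc
    exact absurd hj (h0 (Finset.mem_univ j))

/-- an `S`-neighbour that is not a corner face is odd. [cite: KhristoforovSmirnov2021, §2 Lemma 4 (p. 4), proof and Fig. 3 (loop configurations grouped in triples at a vertex)] -/
private theorem hbK_odd_opp {v : HexVertex} (hv : AllSides D v) {S : Finset (Fin 3)} {ζ : Finset (Sym2 (Site 2))}
    (hq : IsCoreb D v S ζ) {i : Fin 3} (hi : i ∈ S) (hc : oppFace v i ∉ corners D) : Odd (xiDeg ζ (oppFace v i)) :=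
  (hq.2.2 _ (hbK_opp_touching hv i)).2 (Finset.mem_symmDiff.2 (Or.inr ⟨Finset.mem_image.2 ⟨i, hi, rfl⟩, hc⟩))

/-- a corner which is not an `S`-neighbour is odd. [cite: KhristoforovSmirnov2021, §2 Lemma 4 (p. 4), proof and Fig. 3 (loop configurations grouped in triples at a vertex)] -/
theorem hbK_odd_yc {v : HexVertex} {S : Finset (Fin 3)} {ζ : Finset (Sym2 (Site 2))} (hq : IsCoreb D v S ζ) (a : Fin nm)
    (ha : ∀ i ∈ S, oppFace v i ≠ yc D a) : Odd (xiDeg ζ (yc D a)) :=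
  (hq.2.2 _ (yc_mem_touching D a)).2 (Finset.mem_symmDiff.2 (Or.inl ⟨yc_mem_corners D a, fun h => by
    obtain ⟨i, hi, e⟩ := Finset.mem_image.1 h; exact ha i hi e⟩))

/-- **no three odd faces in a component of a boundary core.** [cite: KhristoforovSmirnov2021, §2 Lemma 4 (p. 4), proof and Fig. 3 (loop configurations grouped in triples at a vertex)] -/
private theorem hbK_no_three {v : HexVertex} {S : Finset (Fin 3)} {ζ : Finset (Sym2 (Site 2))} (hq : IsCoreb D v S ζ) {Y₁ Y₂ Y₃ : HexVertex}
    (h1 : Y₁ ∈ triFacesTouching D.verts) (o1 : Odd (xiDeg ζ Y₁)) (o2 : Odd (xiDeg ζ Y₂)) (o3 : Odd (xiDeg ζ Y₃))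
    (r12 : (sideGraph ζ).Reachable Y₁ Y₂) (r13 : (sideGraph ζ).Reachable Y₁ Y₃) (n12 : Y₁ ≠ Y₂) (n13 : Y₁ ≠ Y₃) (n23 : Y₂ ≠ Y₃) :
    False :=
  n23 ((odd_component D (hbK_core_sub hq).1 (hbK_core_deg_le_two hq) h1 o1).2 Y₂ Y₃ r12 r13 o2 o3 n12.symm n13.symm)

/-- **blindness**: two `S`-neighbours linked to each other in a boundary core are linked to no corner (and neither is a corner face). [cite: KhristoforovSmirnov2021, §2 Lemma 4 (p. 4), proof and Fig. 3 (loop configurations grouped in triples at a vertex)] -/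
theorem hbK_blind {v : HexVertex} (hv : AllSides D v) {S : Finset (Fin 3)} {ζ : Finset (Sym2 (Site 2))}
    (hq : IsCoreb D v S ζ) {i₀ i₁ : Fin 3} (h0 : i₀ ∈ S) (h1 : i₁ ∈ S) (hne : i₀ ≠ i₁)
    (hl : (sideGraph ζ).Reachable (oppFace v i₀) (oppFace v i₁)) (a : Fin nm) :
    ¬ (sideGraph ζ).Reachable (oppFace v i₀) (yc D a) ∧ ¬ (sideGraph ζ).Reachable (oppFace v i₁) (yc D a) := by
  have n01 : oppFace v i₀ ≠ oppFace v i₁ := fun e => hne (oppFace_injective' v e)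
  have hc0 : oppFace v i₀ ∉ corners D := fun hc => n01 (hbK_corner_nbr_reach hv hq h0 hc hl).symm
  have hc1 : oppFace v i₁ ∉ corners D := fun hc => n01 (hbK_corner_nbr_reach hv hq h1 hc hl.symm)
  have o0 := hbK_odd_opp hv hq h0 hc0
  have o1 := hbK_odd_opp hv hq h1 hc1
  have ht := hbK_opp_touching hv i₀
  by_cases hya : ∃ i ∈ S, oppFace v i = yc D a
  · obtain ⟨i₂, hi₂, he⟩ := hya
    have hc2 : oppFace v i₂ ∈ corners D := by rw [he]; exact yc_mem_corners D a
    have h20 : oppFace v i₀ ≠ oppFace v i₂ := fun e => hc0 (e ▸ hc2)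
    have h21 : oppFace v i₁ ≠ oppFace v i₂ := fun e => hc1 (e ▸ hc2)
    rw [← he]
    exact ⟨fun hr => h20 (hbK_corner_nbr_reach hv hq hi₂ hc2 hr.symm), fun hr => h21 (hbK_corner_nbr_reach hv hq hi₂ hc2 hr.symm)⟩
  · push Not at hya
    have oa := hbK_odd_yc hq a hya
    have n0a := hya i₀ h0
    have n1a := hya i₁ h1
    exact ⟨fun hr => hbK_no_three hq ht o0 o1 oa hl hr n01 n0a n1a,
      fun hr => hbK_no_three hq ht o0 o1 oa hl (hl.trans hr) n01 n0a n1a⟩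

/-- pigeonhole in `Fin 3`. [folklore] -/
private theorem hbK_fin3_third {i₀ i₁ i i' : Fin 3} (h : i₀ ≠ i₁) (hi : i ≠ i₀) (hi1 : i ≠ i₁) (hi' : i' ≠ i₀) (hi'1 : i' ≠ i₁) :
    i = i' := by
  revert i₀ i₁ i i'; decide

/-- pigeonhole in `Fin 3`. [folklore] -/
private theorem hbK_fin3_or {i₀ i₁ i₃ k : Fin 3} (h : i₀ ≠ i₁) (h0 : i₃ ≠ i₀) (h1 : i₃ ≠ i₁) (hk : k ≠ i₃) : k = i₀ ∨ k = i₁ := by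
  revert i₀ i₁ i₃ k; decide

/-- **attachment lemma** (the tree's `ht2_reach_attach` under `AllSides`). [cite: KhristoforovSmirnov2021, §2 Lemma 4 (p. 4), proof and Fig. 3 (loop configurations grouped in triples at a vertex)] -/
private theorem hbK_reach_attach {v : HexVertex} (hv : AllSides D v) {A : Finset (Sym2 (Site 2))}
    (hAv : ∀ j : Fin 3, side v j ∉ A) (T : Finset (Fin 3)) {Y : HexVertex} (hY : Y ≠ v) (F : HexVertex) :
    (sideGraph (A ∪ T.image (side v))).Reachable Y F ↔
      (F ≠ v ∧ ((sideGraph A).Reachable Y F ∨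
        ∃ i ∈ T, ∃ i' ∈ T, (sideGraph A).Reachable Y (oppFace v i) ∧ (sideGraph A).Reachable (oppFace v i') F)) ∨
      (F = v ∧ ∃ i ∈ T, (sideGraph A).Reachable Y (oppFace v i)) := by
  classical
  have hvi : ∀ i ∈ T, (sideGraph (A ∪ T.image (side v))).Adj v (oppFace v i) := fun i hi =>
    ⟨i, rfl, Finset.mem_union_right _ (Finset.mem_image.2 ⟨i, hi, rfl⟩)⟩
  have hle : sideGraph A ≤ sideGraph (A ∪ T.image (side v)) := ht2_sideGraph_mono Finset.subset_union_left
  constructor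
  · intro h
    rw [SimpleGraph.reachable_iff_reflTransGen] at h
    induction h with
    | refl => exact Or.inl ⟨hY, Or.inl SimpleGraph.Reachable.rfl⟩
    | @tail b c _ hbc ih =>
      obtain ⟨j, hc, hj⟩ := hbc
      rcases ih with ⟨hbv, hb⟩ | ⟨hbv, i, hi, hri⟩
      · rcases Finset.mem_union.1 hj with hjA | hjX
        · have hcv : c ≠ v := by
            intro hcv
            rw [hcv] at hc
            have hs : side v (oppIdx b j) = side b j := by rw [hc, side_oppFace_oppIdx]
            exact hAv (oppIdx b j) (hs ▸ hjA)
          have hstep : (sideGraph A).Adj b c := ⟨j, hc, hjA⟩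
          refine Or.inl ⟨hcv, ?_⟩
          rcases hb with hb | ⟨i, hi, i', hi', h1, h2⟩
          · exact Or.inl (hb.trans hstep.reachable)
          · exact Or.inr ⟨i, hi, i', hi', h1, h2.trans hstep.reachable⟩
        · obtain ⟨i, hiT, hside⟩ := Finset.mem_image.1 hjX
          have hbt : b ∈ triFacesTouching D.verts := mem_touching_of_side_mem D (hside ▸ hv i)
          rcases (l3K_exists_side_eq_iff D (hv i) hbt).1 ⟨j, hside.symm⟩ with hb1 | hb1
          · exact absurd hb1 hbv
          · have hjidx : j = oppIdx v i := by
              rw [hb1, ← side_oppFace_oppIdx v i] at hside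
              exact (side_injective _ hside).symm
            have hcv : c = v := by rw [hc, hb1, hjidx, oppFace_oppFace]
            refine Or.inr ⟨hcv, ?_⟩
            rcases hb with hb | ⟨i₁, hi₁, i', -, h1, -⟩
            · exact ⟨i, hiT, hb1 ▸ hb⟩
            · exact ⟨i₁, hi₁, h1⟩
      · rw [hbv] at hc hj
        have hjT : j ∈ T := by
          rcases Finset.mem_union.1 hj with hjA | hjX
          · exact absurd hjA (hAv j)
          · obtain ⟨i', hi', he⟩ := Finset.mem_image.1 hjX
            rw [← side_injective _ he]; exact hi'
        have hcv : c ≠ v := by rw [hc]; exact (hexGraph_adj_oppFace _ j).ne.symm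
        exact Or.inl ⟨hcv, Or.inr ⟨i, hi, j, hjT, hri, by rw [hc]⟩⟩
  · rintro (⟨-, h | ⟨i, hi, i', hi', h1, h2⟩⟩ | ⟨hFv, i, hi, h⟩)
    · exact h.mono hle
    · have s1 : (sideGraph (A ∪ T.image (side v))).Adj (oppFace v i) v := (hvi i hi).symm
      have s2 : (sideGraph (A ∪ T.image (side v))).Adj v (oppFace v i') := hvi i' hi'
      exact (((h1.mono hle).trans s1.reachable).trans s2.reachable).trans (h2.mono hle)
    · subst hFv
      exact (h.mono hle).trans (hvi i hi).symm.reachable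

/-- **the odd endpoint of every completion is linked to `y_a` iff some `S`-neighbour is linked to `y_a` in the core** (HT2∂ hypothesis). [cite: KhristoforovSmirnov2021, §2 Lemma 4 (p. 4), proof and Fig. 3 (loop configurations grouped in triples at a vertex)] -/
theorem hbK_end_link_iff {v : HexVertex} (hv : AllSides D v) {S : Finset (Fin 3)} {ζ : Finset (Sym2 (Site 2))}
    (hq : IsCoreb D v S ζ) (hinv : S.card = 1 ∨ ∃ i ∈ S, ∃ i' ∈ S, i ≠ i' ∧ XiLinked ζ (oppFace v i) (oppFace v i'))
    (k : Fin 3) (a : Fin nm) :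
    (sideGraph (coreCompl v S k ζ)).Reachable (coreEnd v S k) (yc D a) ↔
      ∃ i ∈ S, (sideGraph ζ).Reachable (oppFace v i) (yc D a) := by
  obtain ⟨-, hside⟩ := hbK_core_sub hq
  have hav := hbK_yc_ne_v hv a
  unfold coreCompl coreEnd
  split_ifs with hk
  · have hkv : oppFace v k ≠ v := (hexGraph_adj_oppFace v k).ne.symm
    rw [hbK_reach_attach hv hside (S.erase k) hkv]
    constructor
    · rintro (⟨-, h | ⟨i, -, i', hi', -, h2⟩⟩ | ⟨h, -⟩)
      · exact ⟨k, hk, h⟩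
      · exact ⟨i', Finset.mem_of_mem_erase hi', h2⟩
      · exact absurd h hav
    · rintro ⟨i₃, hi₃, h3⟩
      by_cases e : i₃ = k
      · subst e
        exact Or.inl ⟨hav, Or.inl h3⟩
      · rcases hinv with hc | ⟨i₀, h0, i₁, h1, hne, hl⟩
        · exact absurd (Finset.card_le_one.1 hc.le i₃ hi₃ k hk) e
        · rw [xiLinked_iff_reachable] at hl
          have hb := hbK_blind hv hq h0 h1 hne hl a
          have h30 : i₃ ≠ i₀ := fun e' => hb.1 (by rw [← e']; exact h3)
          have h31 : i₃ ≠ i₁ := fun e' => hb.2 (by rw [← e']; exact h3)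
          refine Or.inl ⟨hav, Or.inr ?_⟩
          rcases hbK_fin3_or hne h30 h31 (fun h => e h.symm) with rfl | rfl
          · exact ⟨i₁, Finset.mem_erase.2 ⟨hne.symm, h1⟩, i₃, Finset.mem_erase.2 ⟨e, hi₃⟩, hl, h3⟩
          · exact ⟨i₀, Finset.mem_erase.2 ⟨hne, h0⟩, i₃, Finset.mem_erase.2 ⟨e, hi₃⟩, hl.symm, h3⟩
  · rw [Finset.erase_eq_self.2 hk, SimpleGraph.reachable_comm, hbK_reach_attach hv hside S hav]
    constructor
    · rintro (⟨h, -⟩ | ⟨-, i, hi, h⟩)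
      · exact absurd rfl h
      · exact ⟨i, hi, h.symm⟩
    · rintro ⟨i, hi, h⟩
      exact Or.inr ⟨rfl, i, hi, h.symm⟩


/-- **the class of every completion, read in the core** (HT2 hypothesis). [cite: KhristoforovSmirnov2021, §2 Lemma 4 (p. 4), proof and Fig. 3 (loop configurations grouped in triples at a vertex)] -/
theorem hbK_complClassX_iff {v : HexVertex} (hv : AllSides D v) {S : Finset (Fin 3)} {ζ : Finset (Sym2 (Site 2))}
    (hq : IsCoreb D v S ζ) (hinv : S.card = 1 ∨ ∃ i ∈ S, ∃ i' ∈ S, i ≠ i' ∧ XiLinked ζ (oppFace v i) (oppFace v i'))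
    (i : Fin 3) (r : Fin nm) :
    ComplClassX D v S i ζ r ↔ ∃ i₀ ∈ S, (sideGraph ζ).Reachable (oppFace v i₀) (yc D r) := by
  have hmem : coreCompl v S i ζ ∈ loopSpaceX D (faceVertex v (i + 1)) (faceVertex v (i + 2)) (coreEnd v S i) :=
    hbK_compl_mem hv i S ζ hq
  unfold ComplClassX
  rw [hbK_inClassX_iff, hbK_end_link_iff hv hq hinv i r]
  exact ⟨fun h => h.2, fun h => ⟨hmem, h⟩⟩

variable (D) in
/-- **HT2 `InvariantTriplesX` holds for every marked domain.** [cite: KhristoforovSmirnov2021, §2 Lemma 4 (p. 4), proof and Fig. 3 (loop configurations grouped in triples at a vertex)] -/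
theorem invariantTriplesX_holds : InvariantTriplesX D := by
  intro v hv S ζ hq hinv i i' r
  rw [hbK_complClassX_iff hv hq hinv i r, hbK_complClassX_iff hv hq hinv i' r]


/-! ## Part V — the class of a completion is unique; regrouping over cores (generic `k`) -/

/-- **degrees in a member of the XOR space at an edge of `v` are at most two** (odd faces are corners, with a side off `H_G`, or the
endpoint `s ∈ {v, oppFace v i}`, which misses the side `side v i`). [cite: KhristoforovSmirnov2021, §1.2 (loop configurations, pp. 2–3)] -/
theorem hxK_deg_le_two {v : HexVertex} (i : Fin 3) {s : HexVertex} (hs : s ∈ ({v, oppFace v i} : Finset HexVertex))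
    {ξ : Finset (Sym2 (Site 2))} (hξ : ξ ∈ TXb D v i s) (F : HexVertex) : xiDeg ξ F ≤ 2 := by
  classical
  rw [mem_TXb_iff] at hξ
  obtain ⟨hsub, hpar⟩ := hξ
  have hξh : ξ ⊆ hBonds D := fun b hb => Finset.mem_of_mem_erase (hsub hb)
  have hk : side v i ∉ ξ := fun h => (Finset.mem_erase.1 (hsub h)).1 rfl
  rw [Finset.mem_insert, Finset.mem_singleton] at hs
  by_cases hF : F ∈ triFacesTouching D.verts
  · by_cases hodd : Odd (xiDeg ξ F)
    · have hmem := (hpar F hF).1 hodd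
      rcases Finset.mem_symmDiff.1 hmem with ⟨hc, -⟩ | ⟨hx, -⟩
      · obtain ⟨a, ha⟩ := (mem_corners D).1 hc
        obtain ⟨j₀, hj₀⟩ := exists_side_not_mem_hBonds_of_corner D ((isCornerFace_iff_eq_yc D).2 ha)
        exact hbK_card_filter_le_two_of_not (j₀ := j₀) fun h => hj₀ (hξh h)
      · rw [Finset.mem_singleton] at hx
        subst hx
        rcases hs with rfl | rfl
        · exact hbK_card_filter_le_two_of_not (j₀ := i) hk
        · refine hbK_card_filter_le_two_of_not (j₀ := oppIdx v i) fun h => ?_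
          have h' : side (oppFace v i) (oppIdx v i) ∈ ξ := h
          rw [side_oppFace_oppIdx] at h'
          exact hk h'
    · have h3 : xiDeg ξ F ≤ 3 := (Finset.card_filter_le _ _).trans (by simp)
      rcases Nat.even_or_odd (xiDeg ξ F) with ⟨m, hm⟩ | ho
      · omega
      · exact absurd ho hodd
  · have : xiDeg ξ F = 0 := by
      unfold xiDeg
      rw [Finset.card_eq_zero, Finset.filter_eq_empty_iff]
      intro j _ hj
      exact hF (mem_touching_of_side_mem D (hξh hj))
    omega

/-- the odd endpoint `s = coreEnd` of a completion lies in `{v, oppFace v i}`. [cite: KhristoforovSmirnov2021, §2 Lemma 4 (p. 4), proof and Fig. 3 (loop configurations grouped in triples at a vertex)] -/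
private theorem hbK_coreEnd_mem (v : HexVertex) (S : Finset (Fin 3)) (i : Fin 3) :
    coreEnd v S i ∈ ({v, oppFace v i} : Finset HexVertex) := by
  rcases ha_coreEnd_eq_or v S i with h | h <;> rw [h] <;> simp

/-- the odd endpoint of a completion touches `G`. [cite: KhristoforovSmirnov2021, §2 Lemma 4 (p. 4), proof and Fig. 3 (loop configurations grouped in triples at a vertex)] -/
private theorem hbK_coreEnd_touching {v : HexVertex} (hv : AllSides D v) (S : Finset (Fin 3)) (i : Fin 3) :
    coreEnd v S i ∈ triFacesTouching D.verts := by
  rcases ha_coreEnd_eq_or v S i with h | h <;> rw [h]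
  · exact hbK_v_touching hv
  · exact hbK_opp_touching hv i

/-- **a corner endpoint is isolated in the completion**: if `coreEnd v S i` is a corner face then it has no side in `coreCompl v S i ζ`. [cite: KhristoforovSmirnov2021, §2 Lemma 4 (p. 4), proof and Fig. 3 (loop configurations grouped in triples at a vertex)] -/
private theorem hbK_coreEnd_corner_isolated {v : HexVertex} (hv : AllSides D v) {S : Finset (Fin 3)} {ζ : Finset (Sym2 (Site 2))}
    (hq : IsCoreb D v S ζ) (i : Fin 3) (hc : coreEnd v S i ∈ corners D) {F : HexVertex}
    (h : (sideGraph (coreCompl v S i ζ)).Reachable (coreEnd v S i) F) : F = coreEnd v S i := by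
  classical
  have hiS : i ∈ S := by
    by_contra hni
    have : coreEnd v S i = v := by unfold coreEnd; rw [if_neg hni]
    exact hbK_v_not_corner hv (this ▸ hc)
  have hend : coreEnd v S i = oppFace v i := by unfold coreEnd; rw [if_pos hiS]
  rw [hend] at hc h ⊢
  have h0 := hbK_corner_nbr_deg_zero hv hq hiS hc
  rw [l1_xiDeg_eq, Finset.card_eq_zero, Finset.filter_eq_empty_iff] at h0
  -- no side of `oppFace v i` lies in the completion
  have hnone : ∀ j : Fin 3, side (oppFace v i) j ∉ coreCompl v S i ζ := by
    intro j hj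
    unfold coreCompl at hj
    rcases Finset.mem_union.1 hj with hζ | himg
    · exact h0 (Finset.mem_univ j) hζ
    · obtain ⟨i', hi', he⟩ := Finset.mem_image.1 himg
      have hii' : i' ≠ i := (Finset.mem_erase.1 hi').1
      have ht : oppFace v i ∈ triFacesTouching D.verts := hbK_opp_touching hv i
      rcases (l3K_exists_side_eq_iff D (hv i') ht).1 ⟨j, he.symm⟩ with e | e
      · exact (h1_ne_oppFace v i) e.symm
      · exact hii' (oppFace_injective' v e).symm
  rw [SimpleGraph.reachable_iff_reflTransGen] at h
  induction h with
  | refl => rfl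
  | tail _ hbc ih =>
    subst ih
    obtain ⟨j, -, hj⟩ := hbc
    exact absurd hj (hnone j)

/-- **THE CLASS OF A COMPLETION IS UNIQUE**: the strand from the odd endpoint of the completion at the `i`-th edge ends at exactly one
corner (Khristoforov–Smirnov §1.2: «IP(ξ) is a union of disjoint paths, matching marked points»). [cite: KhristoforovSmirnov2021, §1.2 (loop configurations, pp. 2–3)] -/
theorem hbK_complClass_existsUnique {v : HexVertex} (hv : AllSides D v) {S : Finset (Fin 3)} {ζ : Finset (Sym2 (Site 2))}
    (hq : IsCoreb D v S ζ) (i : Fin 3) : ∃! j : Fin nm, ComplClassX D v S i ζ j := by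
  classical
  have hmem : coreCompl v S i ζ ∈ TXb D v i (coreEnd v S i) := hbK_compl_mem hv i S ζ hq
  have hiff : ∀ j : Fin nm, ComplClassX D v S i ζ j ↔ (sideGraph (coreCompl v S i ζ)).Reachable (coreEnd v S i) (yc D j) := by
    intro j
    unfold ComplClassX
    rw [hbK_inClassX_iff]
    exact ⟨fun h => h.2, fun h => ⟨hmem, h⟩⟩
  simp only [hiff]
  by_cases hc : coreEnd v S i ∈ corners D
  · obtain ⟨a, ha⟩ := (mem_corners D).1 hc
    refine ⟨a, by rw [ha], fun j hj => ?_⟩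
    have := hbK_coreEnd_corner_isolated hv hq i hc hj
    exact yc_injective D (this.trans ha)
  · have hmem' := hmem
    rw [mem_TXb_iff] at hmem'
    obtain ⟨hsub, hpar⟩ := hmem'
    have hξh : coreCompl v S i ζ ⊆ hBonds D := fun b hb => Finset.mem_of_mem_erase (hsub hb)
    have hst := hbK_coreEnd_touching hv S i
    have hsodd : Odd (xiDeg (coreCompl v S i ζ) (coreEnd v S i)) :=
      (hpar _ hst).2 (Finset.mem_symmDiff.2 (Or.inr ⟨Finset.mem_singleton_self _, hc⟩))
    have hdeg := hxK_deg_le_two (D := D) i (hbK_coreEnd_mem v S i) hmem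
    obtain ⟨⟨Y, hYne, hYodd, hreach⟩, huniq⟩ := odd_component D hξh hdeg hst hsodd
    have hYt : Y ∈ triFacesTouching D.verts := touching_of_reachable D hξh hst hreach
    have hYmem := (hpar Y hYt).1 hYodd
    have hYc : Y ∈ corners D := by
      rcases Finset.mem_symmDiff.1 hYmem with ⟨h, -⟩ | ⟨h, -⟩
      · exact h
      · exact absurd (Finset.mem_singleton.1 h) hYne
    obtain ⟨j₀, hj₀⟩ := (mem_corners D).1 hYc
    refine ⟨j₀, show (sideGraph (coreCompl v S i ζ)).Reachable (coreEnd v S i) (yc D j₀) by rw [← hj₀]; exact hreach,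
      fun j hj => ?_⟩
    have hjne : yc D j ≠ coreEnd v S i := fun e => hc (e ▸ yc_mem_corners D j)
    have hjodd : Odd (xiDeg (coreCompl v S i ζ) (yc D j)) :=
      (hpar _ (yc_mem_touching D j)).2 (Finset.mem_symmDiff.2 (Or.inl ⟨yc_mem_corners D j, fun h => hjne (Finset.mem_singleton.1 h)⟩))
    have hY : Y = yc D j := huniq Y (yc D j) hreach hj hYodd hjodd hYne hjne
    exact yc_injective D (hY.symm.trans hj₀)

open Classical in
/-- **regrouping over boundary cores** (HT1∂). [cite: KhristoforovSmirnov2021, §2 Lemma 4 (p. 4), proof and Fig. 3 (loop configurations grouped in triples at a vertex)] -/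
theorem hbK_regroup {v : HexVertex} (hv : AllSides D v) (k : Fin 3) (G : HexVertex → Finset (Sym2 (Site 2)) → ℂ) :
    ∑ ξ ∈ TXb D v k v, G v ξ + ∑ ξ ∈ TXb D v k (oppFace v k), G (oppFace v k) ξ =
      ∑ q ∈ coreSetb D v, G (coreEnd v q.1 k) (coreCompl v q.1 k q.2) := by
  have hmap : ∀ (S : Finset (Fin 3)) (ζ : Finset (Sym2 (Site 2))), IsCoreb D v S ζ → coreCompl v S k ζ ∈ TXb D v k (coreEnd v S k) :=
    fun S ζ hq => hbK_compl_mem hv k S ζ hq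
  have huniq : ∀ s ∈ ({v, oppFace v k} : Finset HexVertex), ∀ ξ ∈ TXb D v k s,
      ∃! p : Finset (Fin 3) × Finset (Sym2 (Site 2)), IsCoreb D v p.1 p.2 ∧ coreEnd v p.1 k = s ∧ coreCompl v p.1 k p.2 = ξ :=
    fun s hs ξ hξ => hbK_exists_unique hv k hs hξ
  have hne : v ≠ oppFace v k := (hexGraph_adj_oppFace v k).ne
  rw [← Finset.sum_filter_add_sum_filter_not (coreSetb D v) (fun q => coreEnd v q.1 k = v)]
  congr 1
  · symm
    refine Finset.sum_nbij (fun q => coreCompl v q.1 k q.2) (fun q hq => ?_) (fun q₁ hq₁ q₂ hq₂ heq => ?_) (fun ξ hξ => ?_)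
      (fun q hq => ?_)
    · rw [Finset.mem_filter, hbK_mem_coreSetb] at hq
      have := hmap q.1 q.2 hq.1
      rw [hq.2] at this; exact this
    · rw [Finset.mem_coe, Finset.mem_filter, hbK_mem_coreSetb] at hq₁ hq₂
      have hξ := hmap q₁.1 q₁.2 hq₁.1
      rw [hq₁.2] at hξ
      obtain ⟨p, -, hpu⟩ := huniq v (by simp) _ hξ
      have e1 := hpu q₁ ⟨hq₁.1, hq₁.2, rfl⟩
      have e2 := hpu q₂ ⟨hq₂.1, hq₂.2, heq.symm⟩
      exact e1.trans e2.symm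
    · rw [Finset.mem_coe] at hξ
      obtain ⟨p, ⟨hc, hend, hcomp⟩, -⟩ := huniq v (by simp) _ hξ
      exact ⟨p, by rw [Finset.mem_coe, Finset.mem_filter, hbK_mem_coreSetb]; exact ⟨hc, hend⟩, hcomp⟩
    · rw [Finset.mem_filter] at hq
      rw [hq.2]
  · symm
    refine Finset.sum_nbij (fun q => coreCompl v q.1 k q.2) (fun q hq => ?_) (fun q₁ hq₁ q₂ hq₂ heq => ?_) (fun ξ hξ => ?_)
      (fun q hq => ?_)
    · rw [Finset.mem_filter, hbK_mem_coreSetb] at hq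
      have hend : coreEnd v q.1 k = oppFace v k := (ha_coreEnd_eq_or v q.1 k).resolve_left hq.2
      have := hmap q.1 q.2 hq.1
      rw [hend] at this; exact this
    · rw [Finset.mem_coe, Finset.mem_filter, hbK_mem_coreSetb] at hq₁ hq₂
      have hend₁ : coreEnd v q₁.1 k = oppFace v k := (ha_coreEnd_eq_or v q₁.1 k).resolve_left hq₁.2
      have hend₂ : coreEnd v q₂.1 k = oppFace v k := (ha_coreEnd_eq_or v q₂.1 k).resolve_left hq₂.2
      have hξ := hmap q₁.1 q₁.2 hq₁.1
      rw [hend₁] at hξ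
      obtain ⟨p, -, hpu⟩ := huniq (oppFace v k) (by simp) _ hξ
      have e1 := hpu q₁ ⟨hq₁.1, hend₁, rfl⟩
      have e2 := hpu q₂ ⟨hq₂.1, hend₂, heq.symm⟩
      exact e1.trans e2.symm
    · rw [Finset.mem_coe] at hξ
      obtain ⟨p, ⟨hc, hend, hcomp⟩, -⟩ := huniq (oppFace v k) (by simp) _ hξ
      refine ⟨p, ?_, hcomp⟩
      rw [Finset.mem_coe, Finset.mem_filter, hbK_mem_coreSetb]
      exact ⟨hc, by rw [hend]; exact hne.symm⟩
    · rw [Finset.mem_filter] at hq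
      rw [(ha_coreEnd_eq_or v q.1 k).resolve_left hq.2]




/-! ## Part VII-a — marks along the boundary cycle (generic `k`) -/

/-- if position `n + 1` is the `i`-th mark then the dart there is the marked dart … [cite: KhristoforovSmirnov2021, §1.2 (loop configurations, pp. 2–3)] -/
theorem iter_succ_eq_markDart {n : ℕ} {i : Fin nm} (h : (n + 1) % #(triBdryDarts D.verts) = D.pos i) :
    triBdryIter D.verts D.base (n + 1) = D.markDart i := by
  unfold TriMarkedDomain.markDart
  rw [D.isTriDisc.iter_eq_iter_iff, h, Nat.mod_eq_of_lt (D.pos_lt i)]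

/-- … and the dart at position `n` is its predecessor `predDart i`. [cite: KhristoforovSmirnov2021, §1.2 (loop configurations, pp. 2–3)] -/
theorem iter_eq_predDart {n : ℕ} {i : Fin nm} (h : (n + 1) % #(triBdryDarts D.verts) = D.pos i) :
    triBdryIter D.verts D.base n = predDart D i := by
  have hL := D.isTriDisc.card_pos
  have e1 : triBdryIter D.verts D.base (D.pos i + (#(triBdryDarts D.verts) - 1)) =
      triBdryIter D.verts D.base n := by
    rw [D.isTriDisc.iter_eq_iter_iff]
    have e : (n + 1 + (#(triBdryDarts D.verts) - 1)) % #(triBdryDarts D.verts) =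
        n % #(triBdryDarts D.verts) := by
      rw [show n + 1 + (#(triBdryDarts D.verts) - 1) = n + #(triBdryDarts D.verts) by omega,
        Nat.add_mod_right]
    rw [← e, Nat.add_mod (n + 1), h, Nat.add_mod (D.pos i), Nat.mod_add_mod]
  exact e1.symm


/-! ## Part VIII — re-linking cores: partners, the reduced configuration `L_k` (generic `k`) -/

section CoreC

variable {v : HexVertex} (hv : AllSides D v) {ζ : Finset (Sym2 (Site 2))} (hq : IsCoreb D v Finset.univ ζ)
  {p : Fin 3 → Fin nm} (hp : ∀ k : Fin 3, (sideGraph ζ).Reachable (oppFace v k) (yc D (p k)))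
include hv hq hp

/-- a neighbour that is a corner face is its own partner: `y_{p k} = oppFace v k`. [cite: KhristoforovSmirnov2021, §2 Lemma 4 (p. 4), proof and Fig. 3 (loop configurations grouped in triples at a vertex)] -/
private theorem hcK_yc_eq_of_corner {k : Fin 3} (hc : oppFace v k ∈ corners D) : yc D (p k) = oppFace v k :=
  hbK_corner_nbr_reach hv hq (Finset.mem_univ k) hc (hp k)

omit hp in
/-- a corner linked to a non-corner neighbour is no neighbour (hence odd). [cite: KhristoforovSmirnov2021, §2 Lemma 4 (p. 4), proof and Fig. 3 (loop configurations grouped in triples at a vertex)] -/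
theorem hcK_yc_not_img {k : Fin 3} (hc : oppFace v k ∉ corners D) {a : Fin nm} (h : (sideGraph ζ).Reachable (oppFace v k) (yc D a)) :
    ∀ i ∈ (Finset.univ : Finset (Fin 3)), oppFace v i ≠ yc D a := by
  intro i _ e
  have hci : oppFace v i ∈ corners D := by rw [e]; exact yc_mem_corners D a
  have hik : i ≠ k := fun e' => hc (e' ▸ hci)
  have h' : (sideGraph ζ).Reachable (oppFace v i) (oppFace v k) := by rw [e]; exact h.symm
  have := hbK_corner_nbr_reach hv hq (Finset.mem_univ i) hci h'
  exact hik.symm (oppFace_injective' v this)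

/-- a neighbour sees only its own corner. [cite: KhristoforovSmirnov2021, §2 Lemma 4 (p. 4), proof and Fig. 3 (loop configurations grouped in triples at a vertex)] -/
private theorem hcK_opp_corner {k : Fin 3} {a : Fin nm} (h : (sideGraph ζ).Reachable (oppFace v k) (yc D a)) : a = p k := by
  by_cases hc : oppFace v k ∈ corners D
  · have e1 := hcK_yc_eq_of_corner hv hq hp hc
    have e2 := hbK_corner_nbr_reach hv hq (Finset.mem_univ k) hc h
    exact yc_injective D (e2.trans e1.symm)
  · by_contra hne
    have ok := hbK_odd_opp hv hq (Finset.mem_univ k) hc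
    have oa := hbK_odd_yc hq a (hcK_yc_not_img hv hq hc h)
    have op := hbK_odd_yc hq (p k) (hcK_yc_not_img hv hq hc (hp k))
    have nka : oppFace v k ≠ yc D a := fun e => hc (by rw [e]; exact yc_mem_corners D a)
    have nkp : oppFace v k ≠ yc D (p k) := fun e => hc (by rw [e]; exact yc_mem_corners D _)
    exact hbK_no_three hq (hbK_opp_touching hv k) ok op oa (hp k) h nkp nka (fun e => hne (yc_injective D e).symm)

/-- the partners are distinct. [cite: KhristoforovSmirnov2021, §2 Lemma 4 (p. 4), proof and Fig. 3 (loop configurations grouped in triples at a vertex)] -/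
private theorem hcK_p_injective : Function.Injective p := by
  intro k k' h
  by_contra hne
  by_cases hc : oppFace v k ∈ corners D
  · have e1 := hcK_yc_eq_of_corner hv hq hp hc
    have h2 : (sideGraph ζ).Reachable (oppFace v k) (oppFace v k') := by rw [← e1, h]; exact (hp k').symm
    exact hne (oppFace_injective' v (hbK_corner_nbr_reach hv hq (Finset.mem_univ k) hc h2).symm)
  · by_cases hc' : oppFace v k' ∈ corners D
    · have e1 := hcK_yc_eq_of_corner hv hq hp hc'
      have h2 : (sideGraph ζ).Reachable (oppFace v k') (oppFace v k) := by rw [← e1, ← h]; exact (hp k).symm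
      exact hne (oppFace_injective' v (hbK_corner_nbr_reach hv hq (Finset.mem_univ k') hc' h2))
    · have h1 : (sideGraph ζ).Reachable (yc D (p k)) (oppFace v k) := (hp k).symm
      have h2 : (sideGraph ζ).Reachable (yc D (p k)) (oppFace v k') := by rw [h]; exact (hp k').symm
      have op := hbK_odd_yc hq (p k) (hcK_yc_not_img hv hq hc (hp k))
      have nkp : oppFace v k ≠ yc D (p k) := fun e => hc (by rw [e]; exact yc_mem_corners D _)
      have nk'p : oppFace v k' ≠ yc D (p k) := fun e => hc' (by rw [e]; exact yc_mem_corners D _)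
      exact hbK_no_three hq (yc_mem_touching D (p k)) op (hbK_odd_opp hv hq (Finset.mem_univ k) hc)
        (hbK_odd_opp hv hq (Finset.mem_univ k') hc') h1 h2 nkp.symm nk'p.symm (fun e => hne (oppFace_injective' v e))

/-- a neighbour sees no other neighbour. [cite: KhristoforovSmirnov2021, §2 Lemma 4 (p. 4), proof and Fig. 3 (loop configurations grouped in triples at a vertex)] -/
private theorem hcK_opp_opp {k k' : Fin 3} (hne : k ≠ k') : ¬ (sideGraph ζ).Reachable (oppFace v k) (oppFace v k') := by
  intro h
  by_cases hc : oppFace v k ∈ corners D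
  · exact hne (oppFace_injective' v (hbK_corner_nbr_reach hv hq (Finset.mem_univ k) hc h).symm)
  · by_cases hc' : oppFace v k' ∈ corners D
    · exact hne (oppFace_injective' v (hbK_corner_nbr_reach hv hq (Finset.mem_univ k') hc' h.symm))
    · have op := hbK_odd_yc hq (p k) (hcK_yc_not_img hv hq hc (hp k))
      have nkp : oppFace v k ≠ yc D (p k) := fun e => hc (by rw [e]; exact yc_mem_corners D _)
      have nk'p : oppFace v k' ≠ yc D (p k) := fun e => hc' (by rw [e]; exact yc_mem_corners D _)
      exact hbK_no_three hq (hbK_opp_touching hv k) (hbK_odd_opp hv hq (Finset.mem_univ k) hc) op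
        (hbK_odd_opp hv hq (Finset.mem_univ k') hc') (hp k) h nkp (fun e => hne (oppFace_injective' v e)) nk'p.symm

/-- the partner corner of a neighbour sees no other corner. [cite: KhristoforovSmirnov2021, §2 Lemma 4 (p. 4), proof and Fig. 3 (loop configurations grouped in triples at a vertex)] -/
theorem hcK_partner_blind (k : Fin 3) {m : Fin nm} (hm : m ≠ p k) : ¬ (sideGraph ζ).Reachable (yc D (p k)) (yc D m) := by
  intro h
  exact hm (hcK_opp_corner hv hq hp ((hp k).trans h))


/-- faces on the path of `oppFace v k` have no side in `L_k`. [cite: KhristoforovSmirnov2021, §2 Lemma 4 (p. 4), proof and Fig. 3 (loop configurations grouped in triples at a vertex)] -/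
private theorem hcK_no_side_of_reach (k : Fin 3) {F : HexVertex} (hF : (sideGraph ζ).Reachable (oppFace v k) F) (i : Fin 3) :
    side F i ∉ ht3Lk ζ v k := by
  classical
  obtain ⟨hζ, hside⟩ := hbK_core_sub hq
  obtain ⟨hz0, -, -⟩ := restrict_off_component D hζ (oppFace v k) (ht3zk ζ v k) (ht3_mem_zk ζ v k)
  intro hmem
  unfold ht3Lk at hmem
  rcases Finset.mem_union.1 hmem with h | h
  · have h0 := hz0 F hF
    rw [l1_xiDeg_eq, Finset.card_eq_zero, Finset.filter_eq_empty_iff] at h0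
    exact h0 (Finset.mem_univ i) h
  · obtain ⟨i', hi', he⟩ := Finset.mem_image.1 h
    have hFt : F ∈ triFacesTouching D.verts := mem_touching_of_side_mem D (he ▸ hv i')
    rcases (l3K_exists_side_eq_iff D (hv i') hFt).1 ⟨i, he.symm⟩ with hFv | hFo
    · rw [hFv] at hF
      exact (hexGraph_adj_oppFace v k).ne (hbK_reach_v hq hF.symm).symm
    · rw [hFo] at hF
      exact hcK_opp_opp hv hq hp (fun e => (Finset.mem_erase.1 hi').1 e.symm) hF

omit hv hp in
/-- `v` has no side in a boundary core. [cite: KhristoforovSmirnov2021, §2 Lemma 4 (p. 4), proof and Fig. 3 (loop configurations grouped in triples at a vertex)] -/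
private theorem hcK_xiDeg_v : xiDeg ζ v = 0 := by
  classical
  rw [l1_xiDeg_eq, Finset.card_eq_zero, Finset.filter_eq_empty_iff]
  intro j _ hj
  exact (hbK_core_sub hq).2 j hj

omit hq hp in
/-- which faces other than `v` see an odd number of attached sides: exactly the attached neighbours. [cite: KhristoforovSmirnov2021, §2 Lemma 4 (p. 4), proof and Fig. 3 (loop configurations grouped in triples at a vertex)] -/
private theorem hbK_odd_xiDeg_image_iff (T : Finset (Fin 3)) {F : HexVertex} (hF : F ∈ triFacesTouching D.verts) (hFv : F ≠ v) :
    Odd (xiDeg (T.image (side v)) F) ↔ ∃ i ∈ T, F = oppFace v i := by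
  rw [hbK_odd_xiDeg_sides hv T hF]
  constructor
  · rintro (⟨h, -⟩ | h)
    · exact absurd h hFv
    · exact h
  · exact fun h => Or.inr h

/-- **the reduced configuration `L_k` lies in `H_G` and has its odd faces at the corners other than `y_{p k}`.** [cite: KhristoforovSmirnov2021, §1.2 (loop configurations, pp. 2–3)] -/
theorem hcK_Lk_mem (k : Fin 3) : ht3Lk ζ v k ⊆ hBonds D ∧
    ∀ F ∈ triFacesTouching D.verts, (Odd (xiDeg (ht3Lk ζ v k) F) ↔ ∃ j : Fin nm, j ≠ p k ∧ IsCornerFace D j F) := by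
  classical
  obtain ⟨hζ, hside⟩ := hbK_core_sub hq
  obtain ⟨hz0, hzs, -⟩ := restrict_off_component D hζ (oppFace v k) (ht3zk ζ v k) (ht3_mem_zk ζ v k)
  have hzsub : ht3zk ζ v k ⊆ ζ := ht3_zk_subset ζ v k
  have hzside : ∀ j : Fin 3, side v j ∉ ht3zk ζ v k := fun j h => hside j (hzsub h)
  have hpar := hq.2.2
  constructor
  · intro e he
    unfold ht3Lk at he
    rcases Finset.mem_union.1 he with h | h
    · exact hζ (hzsub h)
    · obtain ⟨i, -, rfl⟩ := Finset.mem_image.1 h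
      exact hv i
  · intro F hF
    unfold ht3Lk
    rw [ht2_union_eq_symmDiff hzside, xorDeg_holds]
    have hR : (∃ j : Fin nm, j ≠ p k ∧ IsCornerFace D j F) ↔ (∃ j : Fin nm, j ≠ p k ∧ F = yc D j) := by
      simp only [isCornerFace_iff_eq_yc]
    rw [hR]
    by_cases hFv : F = v
    · rw [hFv, ht2_xiDeg_image_v]
      have hv0 : ¬ (sideGraph ζ).Reachable (oppFace v k) v := fun h =>
        (hexGraph_adj_oppFace v k).ne (hbK_reach_v hq h.symm).symm
      rw [hzs v hv0, hcK_xiDeg_v hq]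
      have hcard : #((Finset.univ : Finset (Fin 3)).erase k) = 2 := by
        rw [Finset.card_erase_of_mem (Finset.mem_univ k), Finset.card_univ, Fintype.card_fin]
      rw [hcard]
      constructor
      · intro h; exact absurd (iff_of_false (by decide) (by decide)) h
      · rintro ⟨j, -, hj⟩; exact absurd hj.symm (hbK_yc_ne_v hv j)
    · by_cases hFr : (sideGraph ζ).Reachable (oppFace v k) F
      · rw [hz0 F hFr, hbK_odd_xiDeg_image_iff hv _ hF hFv]
        have hno : ¬ ∃ i ∈ (Finset.univ : Finset (Fin 3)).erase k, F = oppFace v i := by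
          rintro ⟨i, hi, rfl⟩
          exact hcK_opp_opp hv hq hp (fun e => (Finset.mem_erase.1 hi).1 e.symm) hFr
        constructor
        · intro h; exact absurd (iff_of_false (by decide) hno) h
        · rintro ⟨j, hj, rfl⟩; exact absurd (hcK_opp_corner hv hq hp hFr) hj
      · rw [hzs F hFr, hpar F hF, hbK_odd_xiDeg_image_iff hv _ hF hFv, mem_symmDiff_iff_not_iff]
        have hnot_pk : ∀ j : Fin nm, F = yc D j → j ≠ p k := by
          rintro j rfl e
          exact hFr (by rw [e]; exact hp k)
        by_cases hFo : ∃ i ∈ (Finset.univ : Finset (Fin 3)).erase k, F = oppFace v i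
        · obtain ⟨i, hi, rfl⟩ := hFo
          have hin : oppFace v i ∈ (Finset.univ : Finset (Fin 3)).image (oppFace v) :=
            Finset.mem_image.2 ⟨i, Finset.mem_univ _, rfl⟩
          have hyes : ∃ i' ∈ (Finset.univ : Finset (Fin 3)).erase k, oppFace v i = oppFace v i' := ⟨i, hi, rfl⟩
          constructor
          · intro h
            have hC : oppFace v i ∈ corners D := by
              by_contra hnc
              exact h (iff_of_true (fun hci => hnc (hci.2 hin)) hyes)
            obtain ⟨j, hj⟩ := (mem_corners D).1 hC
            exact ⟨j, hnot_pk j hj, hj⟩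
          · rintro ⟨j, -, e⟩ h'
            have hC : oppFace v i ∈ corners D := by rw [e]; exact yc_mem_corners D j
            exact (h'.2 hyes) (iff_of_true hC hin)
        · have hnI : F ∉ (Finset.univ : Finset (Fin 3)).image (oppFace v) := by
            intro h
            obtain ⟨i, -, e⟩ := Finset.mem_image.1 h
            by_cases hik : i = k
            · apply hFr; rw [← e, hik]
            · exact hFo ⟨i, Finset.mem_erase.2 ⟨hik, Finset.mem_univ _⟩, e.symm⟩
          rw [ht2_not_iff_of_not hFo]
          constructor
          · intro h
            have hC : F ∈ corners D := by
              by_contra hnc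
              exact h (iff_of_false hnc hnI)
            obtain ⟨j, hj⟩ := (mem_corners D).1 hC
            exact ⟨j, hnot_pk j hj, hj⟩
          · rintro ⟨j, -, rfl⟩ h'
            exact hnI (h'.1 (yc_mem_corners D j))

/-- `L_k ⊆ hBonds`. [cite: KhristoforovSmirnov2021, §1.2 (loop configurations, pp. 2–3)] -/
private theorem hcK_Lk_subset (k : Fin 3) : ht3Lk ζ v k ⊆ hBonds D := (hcK_Lk_mem hv hq hp k).1

omit hv hp in
/-- links of the core off the deleted path survive in `L_k`. [cite: KhristoforovSmirnov2021, §1.2 (loop configurations, pp. 2–3)] -/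
private theorem hcK_Lk_reach_of_reach (k : Fin 3) {Y Y' : HexVertex} (hY : ¬ (sideGraph ζ).Reachable (oppFace v k) Y)
    (h : (sideGraph ζ).Reachable Y Y') : (sideGraph (ht3Lk ζ v k)).Reachable Y Y' := by
  obtain ⟨hζ, -⟩ := hbK_core_sub hq
  obtain ⟨-, -, hzl⟩ := restrict_off_component D hζ (oppFace v k) (ht3zk ζ v k) (ht3_mem_zk ζ v k)
  have h' : (sideGraph (ht3zk ζ v k)).Reachable Y Y' := by
    rw [← xiLinked_iff_reachable] at h ⊢
    exact (hzl Y Y' hY).1 h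
  exact h'.mono (ht2_sideGraph_mono (by unfold ht3Lk; exact Finset.subset_union_left))

omit hv hq hp in
/-- `k`, `k + 1`, `k + 2` are distinct. [folklore] -/
private theorem hcK_fin3_ne (k : Fin 3) : k + 1 ≠ k ∧ k + 2 ≠ k ∧ k + 1 ≠ k + 2 := by
  revert k; decide

omit hv hq hp in
/-- the three elements of `Fin 3` from any start. [folklore] -/
private theorem hcK_fin3_cases (k j : Fin 3) : j = k ∨ j = k + 1 ∨ j = k + 2 := by
  revert k j; decide

/-- the two other neighbours' corners are linked through `v` in `L_k`. [cite: KhristoforovSmirnov2021, §2 Lemma 4 (p. 4), proof and Fig. 3 (loop configurations grouped in triples at a vertex)] -/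
private theorem hcK_Lk_reach_pp (k : Fin 3) : (sideGraph (ht3Lk ζ v k)).Reachable (yc D (p (k + 1))) (yc D (p (k + 2))) := by
  classical
  obtain ⟨hζ, hside⟩ := hbK_core_sub hq
  obtain ⟨-, -, hzl⟩ := restrict_off_component D hζ (oppFace v k) (ht3zk ζ v k) (ht3_mem_zk ζ v k)
  have hzside : ∀ j : Fin 3, side v j ∉ ht3zk ζ v k := fun j h => hside j (ht3_zk_subset ζ v k h)
  obtain ⟨hk1, hk2, hk12⟩ := hcK_fin3_ne k
  have h1 : (sideGraph (ht3zk ζ v k)).Reachable (yc D (p (k + 1))) (oppFace v (k + 1)) := by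
    have hnr : ¬ (sideGraph ζ).Reachable (oppFace v k) (yc D (p (k + 1))) := fun h =>
      hk1 (hcK_p_injective hv hq hp (hcK_opp_corner hv hq hp h))
    rw [← xiLinked_iff_reachable]
    exact (hzl _ _ hnr).1 ((xiLinked_iff_reachable _ _ _).2 (hp (k + 1)).symm)
  have h2 : (sideGraph (ht3zk ζ v k)).Reachable (oppFace v (k + 2)) (yc D (p (k + 2))) := by
    have hnr : ¬ (sideGraph ζ).Reachable (oppFace v k) (oppFace v (k + 2)) := hcK_opp_opp hv hq hp hk2.symm
    rw [← xiLinked_iff_reachable]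
    exact (hzl _ _ hnr).1 ((xiLinked_iff_reachable _ _ _).2 (hp (k + 2)))
  unfold ht3Lk
  exact (hbK_reach_attach hv hzside (Finset.univ.erase k) (hbK_yc_ne_v hv (p (k + 1))) (yc D (p (k + 2)))).2
    (Or.inl ⟨hbK_yc_ne_v hv (p (k + 2)), Or.inr ⟨k + 1, Finset.mem_erase.2 ⟨hk1, Finset.mem_univ _⟩, k + 2,
      Finset.mem_erase.2 ⟨hk2, Finset.mem_univ _⟩, h1, h2⟩⟩)

omit hq hp in
/-- an `L_k`-step between faces other than `v` is a step of the core. [cite: KhristoforovSmirnov2021, §2 Lemma 4 (p. 4), proof and Fig. 3 (loop configurations grouped in triples at a vertex)] -/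
private theorem hcK_core_adj_of_Lk_adj (k : Fin 3) {F F' : HexVertex} (h : (sideGraph (ht3Lk ζ v k)).Adj F F') (hF : F ≠ v) (hF' : F' ≠ v) :
    (sideGraph ζ).Adj F F' := by
  classical
  obtain ⟨j, hFj, hmem⟩ := h
  unfold ht3Lk at hmem
  rcases Finset.mem_union.1 hmem with hz | hx
  · exact ⟨j, hFj, ht3_zk_subset ζ v k hz⟩
  · exfalso
    obtain ⟨i, -, he⟩ := Finset.mem_image.1 hx
    have hFt : F ∈ triFacesTouching D.verts := mem_touching_of_side_mem D (he ▸ hv i)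
    rcases (l3K_exists_side_eq_iff D (hv i) hFt).1 ⟨j, he.symm⟩ with h1 | h1
    · exact hF h1
    · apply hF'
      have hjidx : j = oppIdx v i := by
        rw [h1, ← side_oppFace_oppIdx v i] at he
        exact (side_injective _ he).symm
      rw [hFj, h1, hjidx, oppFace_oppFace]


end CoreC



/-- Auxiliary. [folklore] -/
private theorem fin3_cases₈ (v j : Fin 3) : j = v ∨ j = v + 1 ∨ j = v + 2 := by
  revert v j; decide

/-- Auxiliary. [folklore] -/
private theorem fin3_cases₉ (v j : Fin 3) : j = v ∨ j = v + 1 ∨ j = v + 2 := by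
  revert v j; decide

/-! ## Part VI — THREE marks: Khristoforov–Smirnov's Definition 3 (the observable `F = Σ_j τ^j H_j` in loop form) and Lemma 4
(discrete holomorphicity at every vertex with three `H_G`-sides), assembled from HT1/HT2 and the re-linking face HT3 -/

section ThreeMarks

variable (D : TriMarkedDomain 3)

open Classical in
/-- **`N_j(z)`**: the number of loop configurations with disorders at the three corner faces and at the mid-edge `z` of the `i`-th side of `v`
in which `z` is linked to the corner `y_j` — both halves of the subdivided edge (odd endpoint `v` or `oppFace v i`).
[cite: KhristoforovSmirnov2021, §2 Definition 3 (p. 4)] -/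
noncomputable def classCount (v : HexVertex) (i : Fin 3) (j : Fin 3) : ℕ :=
  #((TXb D v i v).filter fun ξ => InClassX D (faceVertex v (i + 1)) (faceVertex v (i + 2)) v j ξ) +
    #((TXb D v i (oppFace v i)).filter fun ξ => InClassX D (faceVertex v (i + 1)) (faceVertex v (i + 2)) (oppFace v i) j ξ)

/-- **Khristoforov–Smirnov's `H_j(z) = P^loop_{Ω,u₁,u₂,u₃,z}[z is linked to u_j]`** at the mid-edge `z` of the `i`-th side of `v`
(uniform measure on the `2^{#Faces(Ω)}` loop configurations; denominator `2 ^ #G`). [cite: KhristoforovSmirnov2021, §2 Definition 3 (p. 4)] -/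
noncomputable def Hobs (v : HexVertex) (i : Fin 3) (j : Fin 3) : ℝ := (classCount D v i j : ℝ) / 2 ^ #D.verts

/-- **Khristoforov–Smirnov's parafermionic observable `F(z) := Σ_{j} τ^j H_j(z)`** (`τ = e^{2πi/3}`; corners indexed anticlockwise by
the marks of `D`) at the mid-edge of the `i`-th side of `v`. [cite: KhristoforovSmirnov2021, §2 Definition 3 (p. 4)] -/
noncomputable def Fobs (v : HexVertex) (i : Fin 3) : ℂ := ∑ j : Fin 3, tau ^ (j : ℕ) * (Hobs D v i j : ℂ)

open Classical in
/-- the weight `Σ_j τ^j · 𝟙[class j]` of one configuration at the `i`-th side of `v` with odd endpoint `s`. [cite: KhristoforovSmirnov2021, §2 Lemma 4 (p. 4), proof] -/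
noncomputable def Gk (v : HexVertex) (i : Fin 3) (s : HexVertex) (ξ : Finset (Sym2 (Site 2))) : ℂ :=
  ∑ j : Fin 3, if InClassX D (faceVertex v (i + 1)) (faceVertex v (i + 2)) s j ξ then tau ^ (j : ℕ) else 0

/-- **HT3 (RE-LINKING TRIPLES), three marks**: in a core whose three neighbours are odd and pairwise unlinked, the neighbour `oppFace v i`
is linked to the corner `y_{p i}` with `p` an anticlockwise ROTATION `p i = i + d` (planarity; the three strands to `v` and the boundary
arcs). [cite: KhristoforovSmirnov2021, §2 Lemma 4, proof and Fig. 3 (p. 4: the re-linking row of triples); Remark 6 (p. 5)] -/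
def ReLinking₃ (D : TriMarkedDomain 3) : Prop :=
  ∀ v : HexVertex, AllSides D v → ∀ ζ : Finset (Sym2 (Site 2)), IsCoreb D v Finset.univ ζ →
    (∀ i i' : Fin 3, i ≠ i' → ¬ XiLinked ζ (oppFace v i) (oppFace v i')) →
    ∀ p : Fin 3 → Fin 3, (∀ i : Fin 3, XiLinked ζ (oppFace v i) (yc D (p i))) → ∃ d : Fin 3, ∀ i : Fin 3, p i = i + d

/-- **KHRISTOFOROV–SMIRNOV'S LEMMA 4 (discrete holomorphicity), `k = 3`, typed** (sides indexed by `oppFace`): at every vertex `v` of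
`H_G` whose three mid-edges are mid-edges of `Ω`, `Σ_{i : Fin 3} τ^i F(z_i) = 0`. [cite: KhristoforovSmirnov2021, §2 Lemma 4 (p. 4)] -/
def KhSLemma4 (D : TriMarkedDomain 3) : Prop :=
  ∀ v : HexVertex, AllSides D v → ∑ i : Fin 3, tau ^ (i : ℕ) * Fobs D v i = 0

variable {D}

/-- `τ² + τ + 1 = 0`. [folklore] -/
private theorem hbK_tau_sum : 1 + tau + tau ^ 2 = 0 := by
  have hprim : IsPrimitiveRoot tau 3 := by
    have h := Complex.isPrimitiveRoot_exp 3 (by norm_num)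
    unfold tau
    convert h using 2
    push_cast
    ring
  have h := hprim.geom_sum_eq_zero (by norm_num : 1 < 3)
  simp only [Finset.sum_range_succ, Finset.sum_range_zero, pow_zero, pow_one, zero_add] at h
  linear_combination h

/-- `τ³ = 1`, as `τ³ − 1 = 0`. [folklore] -/
private theorem hbK_tau_cube : tau ^ 3 - 1 = 0 := by linear_combination (tau - 1) * hbK_tau_sum


open Classical in
/-- the `τ`-weighted class counts at an edge are the sum of the configuration weights. [cite: KhristoforovSmirnov2021, §2 Lemma 4 (p. 4), proof] -/
theorem sum_tau_classCount_eq (v : HexVertex) (i : Fin 3) :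
    ∑ j : Fin 3, tau ^ (j : ℕ) * (classCount D v i j : ℂ) =
      ∑ ξ ∈ TXb D v i v, Gk D v i v ξ + ∑ ξ ∈ TXb D v i (oppFace v i), Gk D v i (oppFace v i) ξ := by
  unfold classCount Gk
  have key : ∀ (T : Finset (Finset (Sym2 (Site 2)))) (s : HexVertex),
      ∑ j : Fin 3, tau ^ (j : ℕ) * (#(T.filter fun ξ => InClassX D (faceVertex v (i + 1)) (faceVertex v (i + 2)) s j ξ) : ℂ) =
        ∑ ξ ∈ T, ∑ j : Fin 3, if InClassX D (faceVertex v (i + 1)) (faceVertex v (i + 2)) s j ξ then tau ^ (j : ℕ) else 0 := by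
    intro T s
    rw [Finset.sum_comm]
    refine Finset.sum_congr rfl fun j _ => ?_
    rw [Finset.card_filter, Nat.cast_sum, Finset.mul_sum]
    refine Finset.sum_congr rfl fun ξ _ => ?_
    split_ifs <;> simp
  push_cast
  simp only [mul_add, Finset.sum_add_distrib]
  rw [key, key]

/-- the weight of a completion is `τ^{j₀}` for its unique class `j₀`. [cite: KhristoforovSmirnov2021, §2 Lemma 4 (p. 4), proof] -/
theorem Gk_compl_eq {v : HexVertex} (hv : AllSides D v) {S : Finset (Fin 3)} {ζ : Finset (Sym2 (Site 2))} (hq : IsCoreb D v S ζ)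
    (i : Fin 3) {j₀ : Fin 3} (hj₀ : ComplClassX D v S i ζ j₀) :
    Gk D v i (coreEnd v S i) (coreCompl v S i ζ) = tau ^ (j₀ : ℕ) := by
  classical
  obtain ⟨j₁, -, huniq⟩ := hbK_complClass_existsUnique hv hq i
  have hcls : ∀ j : Fin 3, ComplClassX D v S i ζ j ↔ j = j₀ := fun j =>
    ⟨fun h => (huniq j h).trans (huniq j₀ hj₀).symm, fun h => h ▸ hj₀⟩
  unfold Gk
  have : ∀ j : Fin 3, (if InClassX D (faceVertex v (i + 1)) (faceVertex v (i + 2)) (coreEnd v S i) j (coreCompl v S i ζ)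
      then tau ^ (j : ℕ) else (0 : ℂ)) = if j = j₀ then tau ^ (j : ℕ) else 0 := by
    intro j
    have e : InClassX D (faceVertex v (i + 1)) (faceVertex v (i + 2)) (coreEnd v S i) j (coreCompl v S i ζ) ↔ j = j₀ := hcls j
    by_cases h : j = j₀
    · rw [if_pos (e.2 h), if_pos h]
    · rw [if_neg (fun h' => h (e.1 h')), if_neg h]
  simp only [this, Finset.sum_ite_eq', Finset.mem_univ, ↓reduceIte]

/-- **every core triple contributes zero** to `Σ_i τ^i · Σ_j τ^j N_j(z_i)` (given HT3). [cite: KhristoforovSmirnov2021, §2 Lemma 4 (p. 4), proof] -/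
theorem core_vanish (h3 : ReLinking₃ D) {v : HexVertex} (hv : AllSides D v) {S : Finset (Fin 3)} {ζ : Finset (Sym2 (Site 2))}
    (hq : IsCoreb D v S ζ) : ∑ i : Fin 3, tau ^ (i : ℕ) * Gk D v i (coreEnd v S i) (coreCompl v S i ζ) = 0 := by
  classical
  by_cases hinv : S.card = 1 ∨ ∃ i ∈ S, ∃ i' ∈ S, i ≠ i' ∧ XiLinked ζ (oppFace v i) (oppFace v i')
  · -- invariant triple: all three completions have the same class
    obtain ⟨j₀, hj₀, -⟩ := hbK_complClass_existsUnique hv hq (0 : Fin 3)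
    have hcls := invariantTriplesX_holds D v hv S ζ hq hinv
    have hG : ∀ i : Fin 3, Gk D v i (coreEnd v S i) (coreCompl v S i ζ) = tau ^ (j₀ : ℕ) := fun i =>
      Gk_compl_eq hv hq i ((hcls i 0 j₀).2 hj₀)
    simp only [hG, ← Finset.sum_mul]
    rw [Fin.sum_univ_three]
    simp only [Fin.val_zero, Fin.val_one, Fin.val_two, pow_zero, pow_one]
    linear_combination (tau ^ (j₀ : ℕ)) * hbK_tau_sum
  · -- re-linking triple: the three neighbours are odd and pairwise unlinked; partners rotate
    have hcard : ¬ S.card = 1 := fun h => hinv (Or.inl h)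
    have hnolink : ∀ i ∈ S, ∀ i' ∈ S, i ≠ i' → ¬ XiLinked ζ (oppFace v i) (oppFace v i') :=
      fun i hi i' hi' hne hl => hinv (Or.inr ⟨i, hi, i', hi', hne, hl⟩)
    have hS : S = Finset.univ := by
      have hle : S.card ≤ 3 := by simpa using Finset.card_le_univ S
      obtain ⟨m, hm⟩ := hq.2.1
      apply Finset.eq_univ_of_card
      simp only [Fintype.card_fin]
      omega
    subst hS
    have hnl : ∀ i i' : Fin 3, i ≠ i' → ¬ XiLinked ζ (oppFace v i) (oppFace v i') :=
      fun i i' hii' => hnolink i (Finset.mem_univ _) i' (Finset.mem_univ _) hii'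
    choose p hp using hbK_core_partners hv hq hnl
    obtain ⟨d, hd⟩ := h3 v hv ζ hq hnl p hp
    -- the class of the completion at `i` is `p i`
    have hcls : ∀ i : Fin 3, ComplClassX D v Finset.univ i ζ (p i) := by
      intro i
      unfold ComplClassX
      rw [hbK_inClassX_iff]
      refine ⟨hbK_compl_mem hv i _ ζ hq, ?_⟩
      have hend : coreEnd v Finset.univ i = oppFace v i := by unfold coreEnd; rw [if_pos (Finset.mem_univ i)]
      rw [hend]
      have hmono : sideGraph ζ ≤ sideGraph (coreCompl v Finset.univ i ζ) := ht2_sideGraph_mono (by unfold coreCompl; exact Finset.subset_union_left)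
      exact ((xiLinked_iff_reachable _ _ _).1 (hp i)).mono hmono
    have hG : ∀ i : Fin 3, Gk D v i (coreEnd v Finset.univ i) (coreCompl v Finset.univ i ζ) = tau ^ ((p i : Fin 3) : ℕ) := fun i =>
      Gk_compl_eq hv hq i (hcls i)
    simp only [hG, hd]
    -- `Σ_i τ^i τ^{i+d} = τ^d (1 + τ² + τ⁴) = 0`
    have h3' : tau ^ 3 = 1 := by linear_combination hbK_tau_cube
    have hpow : ∀ a b : Fin 3, tau ^ ((a + b : Fin 3) : ℕ) = tau ^ (a : ℕ) * tau ^ (b : ℕ) := by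
      intro a b
      rw [← pow_add]
      rcases Nat.lt_or_ge ((a : ℕ) + (b : ℕ)) 3 with h | h
      · rw [Fin.val_add, Nat.mod_eq_of_lt h]
      · have : ((a + b : Fin 3) : ℕ) = (a : ℕ) + (b : ℕ) - 3 := by
          rw [Fin.val_add]; omega
        rw [this]
        have e : (a : ℕ) + (b : ℕ) = ((a : ℕ) + (b : ℕ) - 3) + 3 := by omega
        conv_rhs => rw [e, pow_add, h3', mul_one]
    simp only [hpow]
    rw [Fin.sum_univ_three]
    simp only [Fin.val_zero, Fin.val_one, Fin.val_two, pow_zero, pow_one, one_mul]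
    linear_combination (tau ^ ((d : Fin 3) : ℕ)) * hbK_tau_sum + (tau ^ ((d : Fin 3) : ℕ) * tau) * hbK_tau_cube

open Classical in
/-- **KhS Lemma 4 from HT3** (HT1, HT2 being theorems for every marked domain): the core regrouping. [cite: KhristoforovSmirnov2021, §2 Lemma 4 (p. 4)] -/
theorem khsLemma4_of_relinking (h3 : ReLinking₃ D) : KhSLemma4 D := by
  intro v hv
  have h2G : (2 : ℂ) ^ #D.verts ≠ 0 := pow_ne_zero _ two_ne_zero
  have hF : ∀ i : Fin 3, (2 : ℂ) ^ #D.verts * Fobs D v i = ∑ j : Fin 3, tau ^ (j : ℕ) * (classCount D v i j : ℂ) := by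
    intro i
    unfold Fobs Hobs
    rw [Finset.mul_sum]
    refine Finset.sum_congr rfl fun j _ => ?_
    push_cast
    field_simp
  have key : (2 : ℂ) ^ #D.verts * ∑ i : Fin 3, tau ^ (i : ℕ) * Fobs D v i = 0 := by
    rw [Finset.mul_sum]
    have step : ∀ i : Fin 3, (2 : ℂ) ^ #D.verts * (tau ^ (i : ℕ) * Fobs D v i) =
        ∑ q ∈ coreSetb D v, tau ^ (i : ℕ) * Gk D v i (coreEnd v q.1 i) (coreCompl v q.1 i q.2) := by
      intro i
      rw [mul_left_comm, hF i, sum_tau_classCount_eq, hbK_regroup hv i (fun s ξ => Gk D v i s ξ), Finset.mul_sum]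
    simp only [step]
    rw [Finset.sum_comm]
    refine Finset.sum_eq_zero fun q hq => ?_
    rw [hbK_mem_coreSetb] at hq
    exact core_vanish h3 hv hq
  rcases mul_eq_zero.1 key with h | h
  · exact absurd h h2G
  · exact h

end ThreeMarks


/-! ## Part VII — THREE marks, the colouring bridge: loop configurations with disorders at the corner faces `y₀, y₁` are the
bicoloured-side sets of the colourings of `G` under Bollobás–Riordan's two-colour boundary condition of the frame of `A₀`
(`TriIface3.lean`: `A₀` white, `A₁ ∪ A₂` black — Khristoforov–Smirnov's reference colouring with reference corner `v₂`) -/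

section ColourBridge

variable (D : TriMarkedDomain 3)

/-- three Booleans around a triangle: an even number of unequal adjacent pairs. [folklore] -/
private theorem card_filter_succ_ne_mod_two (b : Fin 3 → Bool) :
    #((Finset.univ : Finset (Fin 3)).filter fun j => b (j + 1) ≠ b (j + 2)) % 2 = 0 := by
  revert b; decide

/-- dropping the side opposite `v`: the two remaining unequal-pair indicators have odd sum iff the two far
colours differ. [folklore] -/
private theorem card_filter_ne_and_mod_two (v : Fin 3) (b : Fin 3 → Bool) :
    #((Finset.univ : Finset (Fin 3)).filter fun j => j ≠ v ∧ b (j + 1) ≠ b (j + 2)) % 2 = 1 ↔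
      b (v + 1) ≠ b (v + 2) := by
  revert v b; decide


/-- the bond `{a, b}` of `𝕋` (with an endpoint in `G`) is BICOLOURED under the colouring `B` of `G` and the frame-`A₀` boundary
colours: the cells seen across it from its two sides have different colours. [cite: BollobasRiordan2006, Ch. 7 Lemma 5 p. 170] -/
def Bic₃ (B : Set (Site 2)) (a b : Site 2) : Prop := D.cellCol₃ B b a ≠ D.cellCol₃ B a b

/-- `Bic₃` is symmetric. [folklore] [cite: KhristoforovSmirnov2021, §2 Definition 3 and Lemma 4 (p. 4)] -/
theorem bic₃_comm (B : Set (Site 2)) (a b : Site 2) : Bic₃ D B a b ↔ Bic₃ D B b a := by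
  unfold Bic₃; exact ne_comm

open Classical in
/-- **the loop configuration `ξ₃(B)` of a colouring**: the `H_G`-bonds that are bicoloured (= the interface sides of
`TriIface3`), the `k = 3` edition of `FivePoint.xiOf`. [cite: KhristoforovSmirnov2021, §1.2 Lemma 2 (p. 3): «e ∈ ξ(σ) iff the colors on the left and on the right of e differ»] -/
noncomputable def xiOf₃ (B : Set (Site 2)) : Finset (Sym2 (Site 2)) :=
  (hBonds D).filter fun e => Sym2.lift ⟨fun a b => Bic₃ D B a b, fun a b => propext (bic₃_comm D B a b)⟩ e

variable {D}

/-- a side of a face is an `H_G`-bond iff it has an endpoint in `G`. [folklore] [cite: KhristoforovSmirnov2021, §2 Definition 3 and Lemma 4 (p. 4)] -/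
theorem side_mem_hBonds_iff (F : HexVertex) (j : Fin 3) : side F j ∈ hBonds D ↔ D.HasG₃ F j := by
  constructor
  · intro h
    obtain ⟨a, b, he, ha, -⟩ := exists_rep_of_mem_hBonds D h
    unfold side at he
    unfold TriMarkedDomain.HasG₃
    rcases Sym2.eq_iff.1 he with ⟨h1, -⟩ | ⟨-, h2⟩
    · exact Or.inl (h1 ▸ ha)
    · exact Or.inr (h2 ▸ ha)
  · intro h
    have hadj := TriMarkedDomain.adj_faceVertex_succ F (j + 1)
    rw [add_assoc] at hadj
    exact mem_hBonds D hadj h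

open Classical in
/-- **a side lies in `ξ₃(B)` iff it is an interface side.** [cite: KhristoforovSmirnov2021, §1.2 Lemma 2 (p. 3)] -/
theorem side_mem_xiOf₃_iff (B : Set (Site 2)) (F : HexVertex) (j : Fin 3) :
    side F j ∈ xiOf₃ D B ↔ D.IsIface₃ B F j := by
  unfold xiOf₃ TriMarkedDomain.IsIface₃
  rw [Finset.mem_filter, side_mem_hBonds_iff]
  unfold side
  rw [Sym2.lift_mk]
  rfl

/-- `ξ₃(B) ⊆ hBonds`. [folklore] [cite: KhristoforovSmirnov2021, §2 Definition 3 and Lemma 4 (p. 4)] -/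
theorem xiOf₃_subset (B : Set (Site 2)) : xiOf₃ D B ⊆ hBonds D := by
  classical
  unfold xiOf₃; exact Finset.filter_subset _ _

open Classical in
/-- the side count of a face in `ξ₃(B)` counts the interface sides, i.e. the sides with an endpoint in `G` whose end cells differ.
[cite: KhristoforovSmirnov2021, §1.2 Lemma 2 (p. 3)] -/
theorem xiDeg_xiOf₃_eq (B : Set (Site 2)) (F : HexVertex) :
    xiDeg (xiOf₃ D B) F = #((Finset.univ : Finset (Fin 3)).filter fun j => D.HasG₃ F j ∧ D.vcol₃ B F (j + 1) ≠ D.vcol₃ B F (j + 2)) := by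
  rw [l1_xiDeg_eq]
  congr 1
  refine Finset.filter_congr fun j _ => ?_
  rw [side_mem_xiOf₃_iff, TriMarkedDomain.isIface_iff₃]

/-- the colour does not change at the reference mark `2` and changes at the marks `0`, `1` (frame of `A₀`). [cite: BollobasRiordan2006, Ch. 7 Claim 10 p. 178] -/
theorem bcolOf₃_sub_one_ne_iff (i : Fin 3) : TriMarkedDomain.bcolOf₃ (i - 1) ≠ TriMarkedDomain.bcolOf₃ i ↔ i ≠ 2 := by
  revert i; decide

/-- the marked dart has stretch index `i` … [folklore] [cite: KhristoforovSmirnov2021, §2 Definition 3 and Lemma 4 (p. 4)] -/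
theorem stretchIdx₃_markDart (i : Fin 3) : D.stretchIdx₃ (D.dpos (D.markDart i)) = i := by
  have h := dpos_predDart_succ D i
  have := (D.stretchIdx_of_succ_mod_eq_pos₃ h).1
  rw [← D.stretchIdx_mod₃, h] at this
  rw [dpos_markDart]
  exact this

/-- … and its predecessor has stretch index `i - 1`. [folklore] [cite: KhristoforovSmirnov2021, §2 Definition 3 and Lemma 4 (p. 4)] -/
theorem stretchIdx₃_predDart (i : Fin 3) : D.stretchIdx₃ (D.dpos (predDart D i)) = i - 1 :=
  (D.stretchIdx_of_succ_mod_eq_pos₃ (dpos_predDart_succ D i)).2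

/-- a type-II face at `v`: the side view of `x_{v+1}`. [folklore] [cite: KhristoforovSmirnov2021, §2 Definition 3 and Lemma 4 (p. 4)] -/
theorem vcol₃_typeII_succ (B : Set (Site 2)) {F : HexVertex} {v : Fin 3}
    (hv1 : faceVertex F (v + 1) ∉ D.verts) (hv2 : faceVertex F (v + 2) ∉ D.verts) :
    D.vcol₃ B F (v + 1) = D.bdryCol₃ (D.dpos (faceVertex F v, faceVertex F (v + 1))) := by
  have e2 : v + 1 + 1 = v + 2 := by rw [add_assoc]; rfl
  have e3 : v + 1 + 2 = v := by rw [add_assoc]; exact add_eq_left.2 (by decide)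
  unfold TriMarkedDomain.vcol₃
  rw [if_neg hv1, e2, if_neg hv2, e3]

/-- … and of `x_{v+2}`. [folklore] [cite: KhristoforovSmirnov2021, §2 Definition 3 and Lemma 4 (p. 4)] -/
theorem vcol₃_typeII_succ_succ (B : Set (Site 2)) {F : HexVertex} {v : Fin 3}
    (hv : faceVertex F v ∈ D.verts) (hv2 : faceVertex F (v + 2) ∉ D.verts) :
    D.vcol₃ B F (v + 2) = D.bdryCol₃ (D.dpos (faceVertex F v, faceVertex F (v + 2))) := by
  have e4 : v + 2 + 1 = v := by rw [add_assoc]; exact add_eq_left.2 (by decide)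
  unfold TriMarkedDomain.vcol₃
  rw [if_neg hv2, e4, if_pos hv]

/-- at a type-II face the sides with an endpoint in `G` are the two at `x_v`. [folklore] [cite: KhristoforovSmirnov2021, §2 Definition 3 and Lemma 4 (p. 4)] -/
theorem hasG₃_iff_of_typeII {F : HexVertex} {v : Fin 3} (hv : faceVertex F v ∈ D.verts)
    (hv1 : faceVertex F (v + 1) ∉ D.verts) (hv2 : faceVertex F (v + 2) ∉ D.verts) (j : Fin 3) :
    D.HasG₃ F j ↔ j ≠ v := by
  have e2 : v + 1 + 1 = v + 2 := by rw [add_assoc]; rfl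
  have e3 : v + 1 + 2 = v := by rw [add_assoc]; exact add_eq_left.2 (by decide)
  have e4 : v + 2 + 1 = v := by rw [add_assoc]; exact add_eq_left.2 (by decide)
  unfold TriMarkedDomain.HasG₃
  rcases fin3_cases₉ v j with rfl | rfl | rfl
  · simp only [ne_eq, not_true_eq_false, iff_false, not_or]; exact ⟨hv1, hv2⟩
  · rw [e2, e3]
    exact ⟨fun _ h => absurd (add_eq_left.1 h) (by decide), fun _ => Or.inr hv⟩
  · rw [e4]
    exact ⟨fun _ h => absurd (add_eq_left.1 h) (by decide), fun _ => Or.inl hv⟩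

open Classical in
/-- **parity at a type-II face**: odd iff the outer colours beyond the two boundary darts out of `x_v` differ. [cite: KhristoforovSmirnov2021, §1.2 Lemma 2 (p. 3)] -/
theorem odd_xiDeg_xiOf₃_iff_of_typeII (B : Set (Site 2)) {F : HexVertex} {v : Fin 3}
    (hv : faceVertex F v ∈ D.verts) (hv1 : faceVertex F (v + 1) ∉ D.verts) (hv2 : faceVertex F (v + 2) ∉ D.verts) :
    Odd (xiDeg (xiOf₃ D B) F) ↔
      D.bdryCol₃ (D.dpos (faceVertex F v, faceVertex F (v + 1))) ≠ D.bdryCol₃ (D.dpos (faceVertex F v, faceVertex F (v + 2))) := by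
  rw [xiDeg_xiOf₃_eq]
  have key : #((Finset.univ : Finset (Fin 3)).filter fun j =>
      D.HasG₃ F j ∧ D.vcol₃ B F (j + 1) ≠ D.vcol₃ B F (j + 2)) =
      #((Finset.univ : Finset (Fin 3)).filter fun j => j ≠ v ∧ D.vcol₃ B F (j + 1) ≠ D.vcol₃ B F (j + 2)) := by
    congr 1
    exact Finset.filter_congr fun j _ => and_congr_left' (hasG₃_iff_of_typeII hv hv1 hv2 j)
  rw [key, Nat.odd_iff, card_filter_ne_and_mod_two v (D.vcol₃ B F), vcol₃_typeII_succ B hv1 hv2,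
    vcol₃_typeII_succ_succ B hv hv2]

open Classical in
/-- **(P₃) THE DISORDERS ARE THE TWO COLOUR-CHANGE CORNERS**: under the frame-`A₀` colouring the faces of odd side count in `ξ₃(B)` are
exactly the corner faces `y₀`, `y₁` (the colour changes at `v₀` and `v₁`, not at `v₂`). [cite: KhristoforovSmirnov2021, §1.2 Lemma 2 (p. 3)] -/
theorem odd_xiDeg_xiOf₃_iff (B : Set (Site 2)) (F : HexVertex) :
    Odd (xiDeg (xiOf₃ D B) F) ↔ ∃ i : Fin 3, i ≠ 2 ∧ IsCornerFace D i F := by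
  by_cases hII : ∃ v : Fin 3, faceVertex F v ∈ D.verts ∧ faceVertex F (v + 1) ∉ D.verts ∧ faceVertex F (v + 2) ∉ D.verts
  · obtain ⟨v, hv, hv1, hv2⟩ := hII
    rw [odd_xiDeg_xiOf₃_iff_of_typeII B hv hv1 hv2]
    have hd₁ : (faceVertex F v, faceVertex F (v + 1)) ∈ triBdryDarts D.verts := D.faceDart_mem₃ hv hv1
    have hsucc : triBdrySucc D.verts (faceVertex F v, faceVertex F (v + 1)) = (faceVertex F v, faceVertex F (v + 2)) := by
      rw [D.succ_faceDart₃, if_neg hv2]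
    have hd₂ : (faceVertex F v, faceVertex F (v + 2)) ∈ triBdryDarts D.verts := hsucc ▸ triBdrySucc_mem hd₁
    constructor
    · intro hne
      obtain ⟨i, hi⟩ : ∃ i : Fin 3, (D.dpos (faceVertex F v, faceVertex F (v + 1)) + 1) % #(triBdryDarts D.verts) = D.pos i := by
        have := D.exists_pos_of_bdryCol_ne₃ hd₁ (by rw [hsucc]; exact hne.symm)
        exact this
      have h2 : (faceVertex F v, faceVertex F (v + 2)) = D.markDart i := by
        have := iter_succ_eq_markDart (D := D) hi
        rwa [triBdryIter_succ, D.iter_dpos hd₁, hsucc] at this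
      have h1 : (faceVertex F v, faceVertex F (v + 1)) = predDart D i := by
        have := iter_eq_predDart (D := D) hi
        rwa [D.iter_dpos hd₁] at this
      refine ⟨i, ?_, ?_⟩
      · rw [h1, h2] at hne
        unfold TriMarkedDomain.bdryCol₃ at hne
        rw [stretchIdx₃_predDart, stretchIdx₃_markDart] at hne
        exact (bcolOf₃_sub_one_ne_iff i).1 hne
      · unfold IsCornerFace
        have em : D.markSite i = faceVertex F v := (congrArg Prod.fst h2).symm
        have eo : (D.markDart i).2 = faceVertex F (v + 2) := (congrArg Prod.snd h2).symm
        have eo' : (predDart D i).2 = faceVertex F (v + 1) := (congrArg Prod.snd h1).symm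
        rw [hexFaceVertices_eq_triple F v, em, eo, eo', Finset.pair_comm]
    · rintro ⟨i, hir, hcorner⟩
      obtain ⟨w, hw, hw1, hw2, hor⟩ := isCornerFace_typeII D hcorner
      have hwv : w = v := by
        rcases fin3_cases₉ v w with e | e | e
        · exact e
        · exact absurd (e ▸ hw ▸ markSite_mem D i) hv1
        · exact absurd (e ▸ hw ▸ markSite_mem D i) hv2
      subst hwv
      unfold TriMarkedDomain.bdryCol₃
      rcases hor with ⟨e1, e2⟩ | ⟨e1, e2⟩
      · have hp : (faceVertex F w, faceVertex F (w + 1)) = predDart D i :=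
          Prod.ext (by rw [predDart_fst, hw]) e1
        have hm : (faceVertex F w, faceVertex F (w + 2)) = D.markDart i := Prod.ext hw e2
        rw [hp, hm, stretchIdx₃_predDart, stretchIdx₃_markDart]
        exact (bcolOf₃_sub_one_ne_iff i).2 hir
      · have hm : (faceVertex F w, faceVertex F (w + 1)) = D.markDart i := Prod.ext hw e1
        have hp : (faceVertex F w, faceVertex F (w + 2)) = predDart D i :=
          Prod.ext (by rw [predDart_fst, hw]) e2
        rw [hp, hm, stretchIdx₃_predDart, stretchIdx₃_markDart]
        exact ((bcolOf₃_sub_one_ne_iff i).2 hir).symm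
  · push Not at hII
    constructor
    · intro hodd
      exfalso
      rw [xiDeg_xiOf₃_eq] at hodd
      by_cases h0 : ∃ v : Fin 3, faceVertex F v ∈ D.verts
      · obtain ⟨v, hv⟩ := h0
        have hall : ∀ j : Fin 3, D.HasG₃ F j := by
          intro j
          by_contra hno
          have h1 : faceVertex F (j + 1) ∉ D.verts := fun h => hno (Or.inl h)
          have h2 : faceVertex F (j + 2) ∉ D.verts := fun h => hno (Or.inr h)
          have h0 : faceVertex F j ∉ D.verts := fun h => h2 (hII j h h1)
          rcases fin3_cases₉ j v with e | e | e
          · exact h0 (e ▸ hv)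
          · exact h1 (e ▸ hv)
          · exact h2 (e ▸ hv)
        have key : #((Finset.univ : Finset (Fin 3)).filter fun j =>
            D.HasG₃ F j ∧ D.vcol₃ B F (j + 1) ≠ D.vcol₃ B F (j + 2)) =
            #((Finset.univ : Finset (Fin 3)).filter fun j => D.vcol₃ B F (j + 1) ≠ D.vcol₃ B F (j + 2)) := by
          congr 1
          exact Finset.filter_congr fun j _ => and_iff_right (hall j)
        rw [key, Nat.odd_iff, card_filter_succ_ne_mod_two (D.vcol₃ B F)] at hodd
        exact absurd hodd (by decide)
      · push Not at h0
        have key : ((Finset.univ : Finset (Fin 3)).filter fun j =>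
            D.HasG₃ F j ∧ D.vcol₃ B F (j + 1) ≠ D.vcol₃ B F (j + 2)) = ∅ := by
          refine Finset.filter_eq_empty_iff.2 fun j _ h => ?_
          rcases h.1 with h' | h'
          · exact h0 _ h'
          · exact h0 _ h'
        rw [key, Finset.card_empty] at hodd
        exact absurd hodd (by decide)
    · rintro ⟨i, -, hcorner⟩
      obtain ⟨w, hw, hw1, hw2, -⟩ := isCornerFace_typeII D hcorner
      exact absurd (hII w (hw ▸ markSite_mem D i) hw1) hw2

/-- the frame-`A₀` parity set: the corner faces of the marks `0` and `1`. [cite: KhristoforovSmirnov2021, §1.2 Lemma 2 (p. 3)] -/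
theorem mem_pair_yc_iff (F : HexVertex) : F ∈ ({yc D 0, yc D 1} : Finset HexVertex) ↔ ∃ i : Fin 3, i ≠ 2 ∧ IsCornerFace D i F := by
  rw [Finset.mem_insert, Finset.mem_singleton]
  constructor
  · rintro (rfl | rfl)
    · exact ⟨0, by decide, yc_spec D 0⟩
    · exact ⟨1, by decide, yc_spec D 1⟩
  · rintro ⟨i, hi, hc⟩
    have e := eq_yc D hc
    have hi01 : i = 0 ∨ i = 1 := by
      fin_cases i
      · exact Or.inl rfl
      · exact Or.inr rfl
      · exact absurd rfl hi
    rcases hi01 with rfl | rfl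
    · exact Or.inl e
    · exact Or.inr e

/-- **(image) `ξ₃(B)` has odd faces exactly `{y₀, y₁}`.** [cite: KhristoforovSmirnov2021, §1.2 Lemma 2 (p. 3)] -/
theorem parityIs_xiOf₃ (B : Set (Site 2)) : ParityIs D (xiOf₃ D B) {yc D 0, yc D 1} := by
  intro F _
  rw [mem_pair_yc_iff, odd_xiDeg_xiOf₃_iff]

/-! ### injectivity: the colouring of `G` is determined by its loop configuration (flood fill from the base site) -/

/-- `Bic₃` across a bond of `G`: the two states differ. [folklore] [cite: KhristoforovSmirnov2021, §2 Definition 3 and Lemma 4 (p. 4)] -/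
theorem bic₃_iff_of_mem_mem (B : Set (Site 2)) {u v : Site 2} (hu : u ∈ D.verts) (hv : v ∈ D.verts) :
    Bic₃ D B u v ↔ (u ∈ B ↔ v ∉ B) := by
  unfold Bic₃ TriMarkedDomain.cellCol₃
  rw [if_pos hu, if_pos hv]
  by_cases h1 : u ∈ B <;> by_cases h2 : v ∈ B <;> simp [h1, h2]

/-- `Bic₃` across a boundary dart: the inner state differs from the outer colour. [folklore] [cite: KhristoforovSmirnov2021, §2 Definition 3 and Lemma 4 (p. 4)] -/
theorem bic₃_iff_of_mem_not_mem (B : Set (Site 2)) {u w : Site 2} (hu : u ∈ D.verts) (hw : w ∉ D.verts) :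
    Bic₃ D B u w ↔ (u ∈ B ↔ D.bdryCol₃ (D.dpos (u, w)) = false) := by
  unfold Bic₃ TriMarkedDomain.cellCol₃
  rw [if_pos hu, if_neg hw]
  by_cases h1 : u ∈ B <;> cases D.bdryCol₃ (D.dpos (u, w)) <;> simp [h1]

open Classical in
/-- membership of a bond in `ξ₃(B)`. [folklore] [cite: KhristoforovSmirnov2021, §2 Definition 3 and Lemma 4 (p. 4)] -/
theorem mk_mem_xiOf₃_iff (B : Set (Site 2)) {u v : Site 2} (hadj : triGraph.Adj u v) (hG : u ∈ D.verts ∨ v ∈ D.verts) :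
    s(u, v) ∈ xiOf₃ D B ↔ Bic₃ D B u v := by
  unfold xiOf₃
  rw [Finset.mem_filter, Sym2.lift_mk]
  exact ⟨fun h => h.2, fun h => ⟨mem_hBonds D hadj hG, h⟩⟩

/-- Auxiliary. [folklore] -/
private theorem iff_propagate₃ {a b a' b' : Prop} (h : (a ↔ ¬b) ↔ (a' ↔ ¬b')) : (a ↔ a') ↔ (b ↔ b') := by
  by_cases ha : a <;> by_cases hb : b <;> by_cases ha' : a' <;> by_cases hb' : b' <;> simp_all

/-- Auxiliary. [folklore] -/
private theorem iff_anchor₃ {a a' c : Prop} (h : (a ↔ c) ↔ (a' ↔ c)) : a ↔ a' := by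
  by_cases ha : a <;> by_cases ha' : a' <;> by_cases hk : c <;> simp_all

/-- **(injectivity) two colourings with the same `ξ₃` agree on `G`.** [cite: KhristoforovSmirnov2021, §1.2 Lemma 2 (p. 3): «This map is a bijection»] -/
theorem xiOf₃_inj {B B' : Set (Site 2)} (hξ : xiOf₃ D B = xiOf₃ D B') : ∀ u ∈ D.verts, (u ∈ B ↔ u ∈ B') := by
  have hstep : ∀ u v : Site 2, u ∈ D.verts → v ∈ D.verts → triGraph.Adj u v →
      ((u ∈ B ↔ u ∈ B') ↔ (v ∈ B ↔ v ∈ B')) := by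
    intro u v hu hv hadj
    have h1 := mk_mem_xiOf₃_iff B hadj (Or.inl hu)
    have h2 := mk_mem_xiOf₃_iff B' hadj (Or.inl hu)
    rw [hξ] at h1
    have key := h1.symm.trans h2
    rw [bic₃_iff_of_mem_mem B hu hv, bic₃_iff_of_mem_mem B' hu hv] at key
    exact iff_propagate₃ key
  have hbase : (D.base.1 ∈ B ↔ D.base.1 ∈ B') := by
    obtain ⟨hu, hw, hadj⟩ := mem_triBdryDarts.1 D.base_mem
    have h1 := mk_mem_xiOf₃_iff B hadj (Or.inl hu)
    have h2 := mk_mem_xiOf₃_iff B' hadj (Or.inl hu)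
    rw [hξ] at h1
    have key := h1.symm.trans h2
    rw [bic₃_iff_of_mem_not_mem B hu hw, bic₃_iff_of_mem_not_mem B' hu hw] at key
    exact iff_anchor₃ key
  intro u hu
  have hreach := D.connected.preconnected ⟨D.base.1, Finset.mem_coe.2 (mem_triBdryDarts.1 D.base_mem).1⟩ ⟨u, Finset.mem_coe.2 hu⟩
  obtain ⟨p⟩ := hreach
  suffices h : ∀ (a b : ↥((D.verts : Finset (Site 2)) : Set (Site 2))) (q : (triGraph.induce ((D.verts : Finset (Site 2)) : Set (Site 2))).Walk a b),
      ((a : Site 2) ∈ B ↔ (a : Site 2) ∈ B') → ((b : Site 2) ∈ B ↔ (b : Site 2) ∈ B') from h _ _ p hbase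
  intro a b q
  induction q with
  | nil => exact id
  | @cons u' x' b' hadj q' ih =>
    intro ha
    have hadj' : triGraph.Adj (u' : Site 2) (x' : Site 2) := hadj
    exact ih ((hstep u' x' (Finset.mem_coe.1 u'.2) (Finset.mem_coe.1 x'.2) hadj').1 ha)

open Classical in
/-- **(surjectivity) every edge set of `H_G` with odd faces exactly `{y₀, y₁}` is the loop configuration of a colouring of `G`**
(injectivity + image + the count `2 ^ #G` of both sides). [cite: KhristoforovSmirnov2021, §1.2 (p. 2, the sentence before Lemma 2): exactly 2^{#F(Ω)} loop configurations with given disorders] -/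
theorem xiOf₃_surj {ξ : Finset (Sym2 (Site 2))} (hξ : ξ ⊆ hBonds D) (hpar : ParityIs D ξ {yc D 0, yc D 1}) :
    ∃ T : Finset (Site 2), T ⊆ D.verts ∧ xiOf₃ D (↑T : Set (Site 2)) = ξ := by
  set W := (hBonds D).powerset.filter (fun ξ => ∀ F ∈ triFacesTouching D.verts, (Odd (xiDeg ξ F) ↔ F ∈ ({yc D 0, yc D 1} : Finset HexVertex))) with hW
  set I := (D.verts.powerset).image (fun S : Finset (Site 2) => xiOf₃ D (↑S : Set (Site 2))) with hI
  have hIsub : I ⊆ W := by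
    intro ζ hζ
    obtain ⟨S, -, rfl⟩ := Finset.mem_image.1 hζ
    rw [hW, Finset.mem_filter, Finset.mem_powerset]
    exact ⟨xiOf₃_subset _, parityIs_xiOf₃ _⟩
  have hIcard : #I = 2 ^ #D.verts := by
    rw [hI, Finset.card_image_of_injOn, Finset.card_powerset]
    intro S hS S' hS' h
    have hS1 := Finset.mem_powerset.1 (Finset.mem_coe.1 hS)
    have hS2 := Finset.mem_powerset.1 (Finset.mem_coe.1 hS')
    ext u
    constructor
    · intro hu
      exact Finset.mem_coe.1 (((xiOf₃_inj h) u (hS1 hu)).1 (Finset.mem_coe.2 hu))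
    · intro hu
      exact Finset.mem_coe.1 (((xiOf₃_inj h) u (hS2 hu)).2 (Finset.mem_coe.2 hu))
  have h01 : yc D 0 ≠ yc D 1 := fun e => absurd (yc_injective D e) (by decide)
  have hWcard : #W = 2 ^ #D.verts := by
    rw [hW]
    exact card_filter_parity_eq D (O := {yc D 0, yc D 1})
      (by intro F hF; rcases Finset.mem_insert.1 hF with rfl | hF
          · exact yc_mem_touching D 0
          · rw [Finset.mem_singleton.1 hF]; exact yc_mem_touching D 1)
      (by rw [Finset.card_pair h01]; exact even_two)
  have hIeq : I = W := Finset.eq_of_subset_of_card_le hIsub (by rw [hIcard, hWcard])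
  have hmem : ξ ∈ W := by
    rw [hW, Finset.mem_filter, Finset.mem_powerset]; exact ⟨hξ, hpar⟩
  rw [← hIeq] at hmem
  obtain ⟨S, hS, hSξ⟩ := Finset.mem_image.1 hmem
  exact ⟨S, Finset.mem_powerset.1 hS, hSξ⟩

end ColourBridge


/-! ## Part IX — THREE marks: chirality of the re-linking cores (the walk of `TriIface3` along the reduced configuration) and
Khristoforov–Smirnov's Lemma 4 for every 3-marked domain -/

section Chirality₃

variable {D : TriMarkedDomain 3}
variable {v : HexVertex} (hv : AllSides D v) {ζ : Finset (Sym2 (Site 2))} (hq : IsCoreb D v Finset.univ ζ)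
  {p : Fin 3 → Fin 3} (hp : ∀ k : Fin 3, (sideGraph ζ).Reachable (oppFace v k) (yc D (p k)))
  {k₂ : Fin 3} (hk₂ : p k₂ = 2)
include hv hq hp hk₂

/-- the reduced configuration at the neighbour whose partner is the reference corner `y₂` has odd faces `{y₀, y₁}`. [cite: KhristoforovSmirnov2021, §1.2 (loop configurations, pp. 2–3)] -/
theorem hc3K_parity : ParityIs D (ht3Lk ζ v k₂) {yc D 0, yc D 1} := by
  intro F hF
  rw [mem_pair_yc_iff, (hcK_Lk_mem hv hq hp k₂).2 F hF, hk₂]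

/-- **the reduced configuration is the loop configuration of a colouring** (frame of `A₀`). [cite: KhristoforovSmirnov2021, §1.2 Lemma 2 (p. 3)] -/
theorem hc3K_exists_B : ∃ T : Finset (Site 2), T ⊆ D.verts ∧ xiOf₃ D (↑T : Set (Site 2)) = ht3Lk ζ v k₂ :=
  xiOf₃_surj (hcK_Lk_subset hv hq hp k₂) (hc3K_parity hv hq hp hk₂)

omit hv hq hp hk₂ in
/-- the frame-`A₀` colours beyond the two darts of the reference mark `2` are black. [cite: BollobasRiordan2006, Ch. 7 Claim 10 p. 178] -/
private theorem hc3K_bcol_two : TriMarkedDomain.bcolOf₃ (2 - 1) = true ∧ TriMarkedDomain.bcolOf₃ 2 = true := by decide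

/-- **the deleted strand is BLACK**: every vertex in `G` of a face on the strand of `oppFace v k₂` lies in the colouring `B`
(its sides are not bicoloured, and at its end, the reference corner `y₂`, both outer cells are black). [cite: BollobasRiordan2006, Ch. 7 Lemma 5 pp. 169–171] -/
theorem hc3K_black {T : Finset (Site 2)} (hB : xiOf₃ D (↑T : Set (Site 2)) = ht3Lk ζ v k₂) {F : HexVertex}
    (hF : (sideGraph ζ).Reachable (oppFace v k₂) F) {w : Fin 3} (hw : faceVertex F w ∈ D.verts) :
    faceVertex F w ∈ (↑T : Set (Site 2)) := by
  classical
  set B : Set (Site 2) := ↑T with hBdef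
  obtain ⟨hζ, -⟩ := hbK_core_sub hq
  have hFy : (sideGraph ζ).Reachable F (yc D 2) := by rw [← hk₂]; exact hF.symm.trans (hp k₂)
  rw [SimpleGraph.reachable_iff_reflTransGen] at hFy
  have mono : ∀ {a : HexVertex}, (sideGraph ζ).Reachable (oppFace v k₂) a → ∀ {i i' : Fin 3}, i ≠ i' →
      faceVertex a i ∈ D.verts → faceVertex a i ∈ B → faceVertex a i' ∈ D.verts → faceVertex a i' ∈ B := by
    intro a ha i i' hii' hi hiB hi'
    obtain ⟨j, hj⟩ := ht3_pair_eq_side a hii'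
    have hnot : s(faceVertex a i, faceVertex a i') ∉ xiOf₃ D B := by
      rw [hB, hj]; exact hcK_no_side_of_reach hv hq hp k₂ ha j
    have hadj : triGraph.Adj (faceVertex a i) (faceVertex a i') :=
      adj_of_mem_hexFaceVertices (faceVertex_mem a i) (faceVertex_mem a i') (fun e => hii' (faceVertex_injective a e))
    rw [mk_mem_xiOf₃_iff B hadj (Or.inl hi), bic₃_iff_of_mem_mem B hi hi'] at hnot
    by_contra hout
    exact hnot ⟨fun _ => hout, fun _ => hiB⟩
  have key : ∀ a : HexVertex, Relation.ReflTransGen (sideGraph ζ).Adj a (yc D 2) →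
      (sideGraph ζ).Reachable (oppFace v k₂) a → ∀ w : Fin 3, faceVertex a w ∈ D.verts → faceVertex a w ∈ B := by
    intro a hab
    induction hab using Relation.ReflTransGen.head_induction_on with
    | refl =>
      intro hra w hw
      obtain ⟨w₀, h0, h1, h2, hor⟩ := isCornerFace_typeII D (yc_spec D 2)
      have hww : w = w₀ := by
        rcases fin3_cases₈ w₀ w with e | e | e
        · exact e
        · exact absurd (e ▸ hw) h1
        · exact absurd (e ▸ hw) h2
      subst hww
      have e1 : w + 2 + 1 = w := TriMarkedDomain.fin3_add_two_add_one w
      have e2 : w + 2 + 2 = w + 1 := TriMarkedDomain.fin3_add_two_add_two w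
      have hside : s(faceVertex (yc D 2) w, faceVertex (yc D 2) (w + 1)) ∉ xiOf₃ D B := by
        have := hcK_no_side_of_reach hv hq hp k₂ hra (w + 2)
        unfold side at this
        rwa [e1, e2, ← hB] at this
      have hadj : triGraph.Adj (faceVertex (yc D 2) w) (faceVertex (yc D 2) (w + 1)) := TriMarkedDomain.adj_faceVertex_succ _ w
      rw [mk_mem_xiOf₃_iff B hadj (Or.inl hw), bic₃_iff_of_mem_not_mem B hw h1] at hside
      have hcol : D.bdryCol₃ (D.dpos (faceVertex (yc D 2) w, faceVertex (yc D 2) (w + 1))) = true := by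
        obtain ⟨c1, c2⟩ := hc3K_bcol_two
        unfold TriMarkedDomain.bdryCol₃
        rcases hor with ⟨hp1, -⟩ | ⟨hm1, -⟩
        · have hd : (faceVertex (yc D 2) w, faceVertex (yc D 2) (w + 1)) = predDart D 2 :=
            Prod.ext (by rw [predDart_fst]; exact h0) hp1
          rw [hd, stretchIdx₃_predDart, c1]
        · have hd : (faceVertex (yc D 2) w, faceVertex (yc D 2) (w + 1)) = D.markDart 2 := Prod.ext h0 hm1
          rw [hd, stretchIdx₃_markDart, c2]
      rw [hcol] at hside
      by_contra hout
      exact hside ⟨fun hin => absurd hin hout, fun h => absurd h (by decide)⟩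
    | head hac hcb ih =>
      rename_i a c
      intro hra w hw
      have hrc : (sideGraph ζ).Reachable (oppFace v k₂) c := hra.trans hac.reachable
      obtain ⟨j, hcj, hmem⟩ := hac
      obtain ⟨x, y, hexy, hxG, -⟩ := exists_rep_of_mem_hBonds D (hζ hmem)
      have hx : x = faceVertex a (j + 1) ∨ x = faceVertex a (j + 2) := by
        unfold side at hexy
        rcases Sym2.eq_iff.1 hexy with ⟨h1, -⟩ | ⟨-, h2⟩
        · exact Or.inl h1.symm
        · exact Or.inr h2.symm
      obtain ⟨i₁, hi₁⟩ : ∃ i₁ : Fin 3, x = faceVertex a i₁ := by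
        rcases hx with h | h
        · exact ⟨j + 1, h⟩
        · exact ⟨j + 2, h⟩
      have hxB : x ∈ B := by
        rcases hx with h | h
        · have hc' : x = faceVertex c (oppIdx a j + 2) := by rw [hcj, faceVertex_oppFace_succ_succ]; exact h
          have := ih hrc (oppIdx a j + 2) (hc' ▸ hxG)
          rwa [← hc'] at this
        · have hc' : x = faceVertex c (oppIdx a j + 1) := by rw [hcj, faceVertex_oppFace_succ]; exact h
          have := ih hrc (oppIdx a j + 1) (hc' ▸ hxG)
          rwa [← hc'] at this
      by_cases hwi : w = i₁
      · rw [hwi, ← hi₁]; exact hxB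
      · exact mono hra (Ne.symm hwi) (hi₁ ▸ hxG) (hi₁ ▸ hxB) hw
  exact key F hFy hF w hw

omit hv hq hp hk₂ in
/-- a black inside vertex has colour `true`. [folklore] -/
private theorem hc3K_vcol_true_of_mem (B : Set (Site 2)) {F : HexVertex} {w : Fin 3}
    (h : faceVertex F w ∈ D.verts) (hw : faceVertex F w ∈ B) : D.vcol₃ B F w = true := by
  classical
  unfold TriMarkedDomain.vcol₃; rw [if_pos h]; simp [hw]

omit hv hq hp hk₂ in
/-- `k`, `k + 1`, `k + 2` are distinct. [folklore] -/
private theorem hc3K_fin3_ne (k : Fin 3) : k + 1 ≠ k ∧ k + 2 ≠ k ∧ k + 1 ≠ k + 2 := by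
  revert k; decide

/-- **the colours around `v`**: the two cells of the side towards the deleted strand are BLACK, the third cell is WHITE; hence the
side towards `oppFace v (k₂+2)` is the ENTRY side of `v` and the side towards `oppFace v (k₂+1)` its EXIT side
(Bollobás–Riordan's orientation: black on the right). [cite: BollobasRiordan2006, Ch. 7 Lemma 5 p. 170] -/
theorem hc3K_colours_at_v {T : Finset (Site 2)} (hB : xiOf₃ D (↑T : Set (Site 2)) = ht3Lk ζ v k₂) :
    D.vcol₃ (↑T : Set (Site 2)) v (k₂ + 1) = true ∧ D.vcol₃ (↑T : Set (Site 2)) v (k₂ + 2) = true ∧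
      D.vcol₃ (↑T : Set (Site 2)) v k₂ = false := by
  classical
  set B : Set (Site 2) := ↑T with hBdef
  obtain ⟨hk1, hk2, hk12⟩ := hc3K_fin3_ne k₂
  have hr : (sideGraph ζ).Reachable (oppFace v k₂) (oppFace v k₂) := SimpleGraph.Reachable.refl _
  -- the side towards `oppFace v k₂` is not bicoloured
  have hsk : side v k₂ ∉ ht3Lk ζ v k₂ := by
    have := hcK_no_side_of_reach hv hq hp k₂ hr (oppIdx v k₂)
    rwa [side_oppFace_oppIdx] at this
  have hnb : ¬ D.IsIface₃ B v k₂ := fun hb => hsk (by rw [← hB]; exact (side_mem_xiOf₃_iff B v k₂).2 hb)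
  have hG : D.HasG₃ v k₂ := (side_mem_hBonds_iff v k₂).1 (hv k₂)
  have heq : D.vcol₃ B v (k₂ + 1) = D.vcol₃ B v (k₂ + 2) := by
    by_contra hne; exact hnb ((D.isIface_iff₃).2 ⟨hG, hne⟩)
  -- one of the two cells is in `G`, hence black
  have c12 : D.vcol₃ B v (k₂ + 1) = true ∧ D.vcol₃ B v (k₂ + 2) = true := by
    rcases hbK_exists_mem hv k₂ with h1 | h2
    · have hmem : faceVertex (oppFace v k₂) (oppIdx v k₂ + 2) ∈ D.verts := by rw [faceVertex_oppFace_succ_succ]; exact h1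
      have hb := hc3K_black hv hq hp hk₂ hB hr hmem
      rw [faceVertex_oppFace_succ_succ] at hb
      have c1 : D.vcol₃ B v (k₂ + 1) = true := hc3K_vcol_true_of_mem B h1 hb
      exact ⟨c1, heq ▸ c1⟩
    · have hmem : faceVertex (oppFace v k₂) (oppIdx v k₂ + 1) ∈ D.verts := by rw [faceVertex_oppFace_succ]; exact h2
      have hb := hc3K_black hv hq hp hk₂ hB hr hmem
      rw [faceVertex_oppFace_succ] at hb
      have c2 : D.vcol₃ B v (k₂ + 2) = true := hc3K_vcol_true_of_mem B h2 hb
      exact ⟨heq.trans c2, c2⟩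
  refine ⟨c12.1, c12.2, ?_⟩
  -- the attached side `side v (k₂+1) = {x_{k₂+2}, x_{k₂}}` is bicoloured
  have hmem : side v (k₂ + 1) ∈ xiOf₃ D B := by
    rw [hB]; unfold ht3Lk
    exact Finset.mem_union_right _ (Finset.mem_image.2 ⟨k₂ + 1, Finset.mem_erase.2 ⟨hk1, Finset.mem_univ _⟩, rfl⟩)
  have e1 : k₂ + 1 + 1 = k₂ + 2 := TriMarkedDomain.fin3_add_one_add_one k₂
  have e2 : k₂ + 1 + 2 = k₂ := TriMarkedDomain.fin3_add_one_add_two k₂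
  have hb := (side_mem_xiOf₃_iff B v (k₂ + 1)).1 hmem
  rw [D.isIface_iff₃, e1, e2, c12.2] at hb
  cases h : D.vcol₃ B v k₂
  · rfl
  · exact absurd h.symm hb.2

/-- the entry side of `v` is the side towards `oppFace v (k₂ + 2)`, its exit side the one towards `oppFace v (k₂ + 1)`. [cite: BollobasRiordan2006, Ch. 7 Lemma 5 p. 170 (oriented interface)] -/
theorem hc3K_entry_exit {T : Finset (Site 2)} (hB : xiOf₃ D (↑T : Set (Site 2)) = ht3Lk ζ v k₂) :
    D.IsEntry₃ (↑T : Set (Site 2)) v (k₂ + 2) ∧ D.IsExit₃ (↑T : Set (Site 2)) v (k₂ + 1) := by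
  obtain ⟨c1, c2, c0⟩ := hc3K_colours_at_v hv hq hp hk₂ hB
  have e1 : k₂ + 1 + 1 = k₂ + 2 := TriMarkedDomain.fin3_add_one_add_one k₂
  have e2 : k₂ + 1 + 2 = k₂ := TriMarkedDomain.fin3_add_one_add_two k₂
  have e3 : k₂ + 2 + 1 = k₂ := TriMarkedDomain.fin3_add_two_add_one k₂
  have e4 : k₂ + 2 + 2 = k₂ + 1 := TriMarkedDomain.fin3_add_two_add_two k₂
  refine ⟨(D.isEntry_iff₃).2 ⟨(side_mem_hBonds_iff v _).1 (hv _), ?_, ?_⟩, (D.isExit_iff₃).2 ⟨(side_mem_hBonds_iff v _).1 (hv _), ?_, ?_⟩⟩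
  · rw [e3]; exact c0
  · rw [e4]; exact c1
  · rw [e1]; exact c2
  · rw [e2]; exact c0

/-- **CHIRALITY**: the neighbour following the one linked to the reference corner `y₂` is linked to `y₀` — the walk of the oriented
interface (black on the right) leaves `v` towards `oppFace v (k₂ + 1)` and can only terminate at the corner `y₀` where the boundary
colour turns white. [cite: BollobasRiordan2006, Ch. 7 Lemma 5 pp. 169–171, Fig. 9] -/
theorem hc3K_next : p (k₂ + 1) = 0 := by
  classical
  obtain ⟨T, -, hB⟩ := hc3K_exists_B hv hq hp hk₂
  set B : Set (Site 2) := ↑T with hBdef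
  obtain ⟨hk1, hk2, hk12⟩ := hc3K_fin3_ne k₂
  obtain ⟨hEv, hXv⟩ := hc3K_entry_exit hv hq hp hk₂ hB
  obtain ⟨hζ, hside⟩ := hbK_core_sub hq
  -- the walk of exits from `v`, stopped at the entry neighbour `w₂ = oppFace v (k₂ + 2)`
  set w₂ := oppFace v (k₂ + 2) with hw₂
  set f : HexVertex → Option HexVertex := fun F => if F = w₂ then none else D.ifaceNext₃ B F with hf
  have hf_of_ne : ∀ {F : HexVertex}, F ≠ w₂ → f F = D.ifaceNext₃ B F := fun h => by simp only [hf, if_neg h]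
  have hf_some : ∀ {F F' : HexVertex}, f F = some F' → F ≠ w₂ ∧ D.ifaceNext₃ B F = some F' := by
    intro F F' h
    by_cases hFw : F = w₂
    · simp only [hf, if_pos hFw] at h; exact absurd h (by simp)
    · exact ⟨hFw, by rwa [hf_of_ne hFw] at h⟩
  -- nothing maps to `v` (its only entry is from `w₂`, where `f` stops)
  have hstart : ∀ x ∈ triFacesTouching D.verts, f x ≠ some v := by
    intro x _ hx
    obtain ⟨hxw, hx'⟩ := hf_some hx
    obtain ⟨j, hj, hvx⟩ := D.ifaceNext_eq_some₃ hx'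
    have hE := D.isEntry_oppFace₃ hj
    rw [← hvx] at hE
    have hidx := D.isEntry_unique₃ hE hEv
    apply hxw
    have : oppFace v (oppIdx x j) = x := by rw [hvx, oppFace_oppFace]
    rw [← this, hidx]
  obtain ⟨n, hsteps, hend⟩ := exists_partialOrbit_end f (triFacesTouching D.verts) v (hbK_v_touching hv)
    (fun x _ y hy => D.ifaceNext_mem₃ (hf_some hy).2)
    (fun x _ x' _ y hy hy' => D.ifaceNext_injective₃ (hf_some hy).2 (hf_some hy').2) hstart
  -- notation for the orbit
  set x : ℕ → HexVertex := partialOrbit f v with hxdef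
  have hx0 : x 0 = v := rfl
  have hvw : v ≠ w₂ := (hexGraph_adj_oppFace v (k₂ + 2)).ne
  -- the first step exists and goes to `w₁ = oppFace v (k₂ + 1)`
  have hn : n ≠ 0 := by
    rintro rfl
    have h := hend
    rw [hx0, hf_of_ne hvw] at h
    exact D.ifaceNext_ne_none₃ hXv h
  have hx1 : x 1 = oppFace v (k₂ + 1) := by
    have h := hsteps 0 (Nat.pos_of_ne_zero hn)
    rw [hx0] at h
    obtain ⟨-, h'⟩ := hf_some h
    obtain ⟨j, hj, he⟩ := D.ifaceNext_eq_some₃ h'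
    rw [he, D.isExit_unique₃ hj hXv]
  -- the orbit avoids `v` after time `0`
  have hxv : ∀ i, 1 ≤ i → i ≤ n → x i ≠ v := by
    intro i hi hin hxi
    obtain ⟨i', rfl⟩ : ∃ i', i = i' + 1 := ⟨i - 1, by omega⟩
    have h := hsteps i' (by omega)
    rw [hxi] at h
    exact hstart _ (by
      cases i' with
      | zero => exact hbK_v_touching hv
      | succ i'' => exact D.ifaceNext_mem₃ (hf_some (hsteps i'' (by omega))).2) h
  -- consecutive orbit points are adjacent in `L`, hence (off `v`) in the core
  have hadjL : ∀ i, i < n → (sideGraph (ht3Lk ζ v k₂)).Adj (x i) (x (i + 1)) := by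
    intro i hi
    obtain ⟨-, h'⟩ := hf_some (hsteps i hi)
    obtain ⟨j, hj, he⟩ := D.ifaceNext_eq_some₃ h'
    refine ⟨j, he, ?_⟩
    rw [← hB]
    exact (side_mem_xiOf₃_iff B _ j).2 hj.1
  have hreach : ∀ i, 1 ≤ i → i ≤ n → (sideGraph ζ).Reachable (oppFace v (k₂ + 1)) (x i) := by
    intro i hi hin
    induction i with
    | zero => exact absurd hi (by omega)
    | succ i ih =>
      rcases Nat.eq_zero_or_pos i with rfl | hipos
      · rw [hx1]
      · have h1 := ih (by omega) (by omega)
        have hst := hcK_core_adj_of_Lk_adj hv k₂ (hadjL i (by omega)) (hxv i (by omega) (by omega)) (hxv (i + 1) (by omega) hin)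
        exact h1.trans hst.reachable
  -- the end of the walk
  have hxn_ne_w₂ : x n ≠ w₂ := by
    intro he
    have hr := hreach n (Nat.pos_of_ne_zero hn) le_rfl
    rw [he] at hr
    exact hcK_opp_opp hv hq hp hk12 hr
  have hnone : D.ifaceNext₃ B (x n) = none := by rw [← hf_of_ne hxn_ne_w₂]; exact hend
  -- the end face is entered through the side of the last step
  obtain ⟨m, hm⟩ : ∃ m, n = m + 1 := ⟨n - 1, by omega⟩
  obtain ⟨-, hlast⟩ := hf_some (hsteps m (by omega))
  obtain ⟨jm, hjm, hxm⟩ := D.ifaceNext_eq_some₃ hlast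
  rw [← hm] at hxm
  have hEn : D.IsEntry₃ B (x n) (oppIdx (x m) jm) := by rw [hxm]; exact D.isEntry_oppFace₃ hjm
  -- it has odd side count `1` in `L`: its only `L`-side is the entry side
  have hdeg : Odd (xiDeg (ht3Lk ζ v k₂) (x n)) := by
    rw [l1_xiDeg_eq]
    have hfilter : ((Finset.univ : Finset (Fin 3)).filter fun j => side (x n) j ∈ ht3Lk ζ v k₂) = {oppIdx (x m) jm} := by
      ext j
      simp only [Finset.mem_filter, Finset.mem_univ, true_and, Finset.mem_singleton]
      constructor
      · intro hj
        rw [← hB] at hj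
        have hif := (side_mem_xiOf₃_iff B _ j).1 hj
        -- an interface side is an entry or an exit
        rcases (by
            obtain ⟨hG, hne⟩ := hif
            cases h1 : D.cellCol₃ B (faceVertex (x n) (j + 2)) (faceVertex (x n) (j + 1))
            · right
              cases h2 : D.cellCol₃ B (faceVertex (x n) (j + 1)) (faceVertex (x n) (j + 2))
              · rw [h1, h2] at hne; exact absurd rfl hne
              · exact ⟨⟨hG, hne⟩, h2⟩
            · left; exact ⟨⟨hG, hne⟩, h1⟩ : D.IsExit₃ B (x n) j ∨ D.IsEntry₃ B (x n) j) with hX | hE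
        · exact absurd hX (D.ifaceNext_eq_none₃ hnone j)
        · exact D.isEntry_unique₃ hE hEn
      · rintro rfl
        rw [← hB]
        exact (side_mem_xiOf₃_iff B _ _).2 hEn.1
    rw [hfilter, Finset.card_singleton]
    exact odd_one
  -- hence it is a corner `y_j`, `j ≠ 2`, linked in the core to `oppFace v (k₂ + 1)`: `j = p (k₂ + 1)`
  have hxt : x n ∈ triFacesTouching D.verts := by rw [hm]; exact D.ifaceNext_mem₃ hlast
  obtain ⟨j, hj2, hjc⟩ := ((hcK_Lk_mem hv hq hp k₂).2 (x n) hxt).1 hdeg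
  rw [hk₂] at hj2
  have hxj : x n = yc D j := eq_yc D hjc
  have hpj : j = p (k₂ + 1) := by
    have hr := hreach n (Nat.pos_of_ne_zero hn) le_rfl
    rw [hxj] at hr
    exact hcK_opp_corner hv hq hp hr
  -- and it is terminal: the boundary colour changes there from black to white, i.e. `j = 0`
  rcases D.exists_isExit_or_isTerminal₃ hEn with ⟨j', hX⟩ | hT
  · exact absurd hX (D.ifaceNext_eq_none₃ hnone j')
  · obtain ⟨i, w, hwi, hcases⟩ := hT
    -- the inside vertex of the corner face `y_j` is the marked site `v_j`
    have hij : i = j := by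
      obtain ⟨w₀, h0, h1, h2, -⟩ := isCornerFace_typeII D hjc
      have hww : w = w₀ := by
        rcases fin3_cases₈ w₀ w with e | e | e
        · exact e
        · exact absurd (e ▸ hwi ▸ markSite_mem D i) h1
        · exact absurd (e ▸ hwi ▸ markSite_mem D i) h2
      subst hww
      exact D.mark_injective (show (triBdryIter D.verts D.base (D.pos i)).1 = (triBdryIter D.verts D.base (D.pos j)).1 from
        hwi.symm.trans h0)
    subst hij
    have hj1 : i ≠ 1 := by
      rintro rfl
      rcases hcases with ⟨-, -, hc, -⟩ | ⟨-, -, hc, -⟩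
      · exact absurd hc (by decide)
      · exact absurd hc (by decide)
    have hj0 : i = 0 := by
      have key : ∀ i : Fin 3, i ≠ 2 → i ≠ 1 → i = 0 := by decide
      exact key i hj2 hj1
    rw [← hpj, hj0]

end Chirality₃

section Lemma4

variable (D : TriMarkedDomain 3)

/-- **HT3 `ReLinking₃` holds for every 3-marked domain**: the three strands of a re-linking core meet the corners in an anticlockwise
rotation. [cite: KhristoforovSmirnov2021, §2 Lemma 4 (p. 4), proof] -/
theorem reLinking₃_holds : ReLinking₃ D := by
  intro v hv ζ hq hnl p hp
  have hp' : ∀ k : Fin 3, (sideGraph ζ).Reachable (oppFace v k) (yc D (p k)) := fun k => (xiLinked_iff_reachable _ _ _).1 (hp k)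
  have hinj : Function.Injective p := hcK_p_injective hv hq hp'
  have hsurj : Function.Surjective p := Finite.surjective_of_injective hinj
  obtain ⟨k₂, hk₂⟩ := hsurj 2
  have h0 : p (k₂ + 1) = 0 := hc3K_next hv hq hp' hk₂
  have hk2ne : ∀ k : Fin 3, k + 2 ≠ k := by decide
  have hk21ne : ∀ k : Fin 3, k + 2 ≠ k + 1 := by decide
  have h1 : p (k₂ + 2) = 1 := by
    have hne2 : p (k₂ + 2) ≠ 2 := fun e => hk2ne k₂ (hinj (e.trans hk₂.symm))
    have hne0 : p (k₂ + 2) ≠ 0 := fun e => hk21ne k₂ (hinj (e.trans h0.symm))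
    have key : ∀ q : Fin 3, q ≠ 2 → q ≠ 0 → q = 1 := by decide
    exact key _ hne2 hne0
  have ea : ∀ k : Fin 3, k + (2 - k) = 2 := by decide
  have eb : ∀ k : Fin 3, k + 1 + (2 - k) = 0 := by decide
  have ec : ∀ k : Fin 3, k + 2 + (2 - k) = 1 := by decide
  refine ⟨2 - k₂, fun i => ?_⟩
  rcases fin3_cases₈ k₂ i with e | e | e <;> rw [e]
  · rw [hk₂, ea]
  · rw [h0, eb]
  · rw [h1, ec]

/-- ★ **KHRISTOFOROV–SMIRNOV'S LEMMA 4 (DISCRETE HOLOMORPHICITY OF THE PARAFERMIONIC OBSERVABLE, three boundary disorders) FOR EVERY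
3-MARKED DISCRETE DOMAIN**: with `H_j(z) = P^loop[z is linked to the corner y_j]` and `F = Σ_j τ^j H_j`, at every vertex `v` of `H_G`
whose three mid-edges are mid-edges of `Ω`, `Σ_{i : Fin 3} τ^i F(z_i) = 0` (sides of `v` indexed by `oppFace`). [cite: KhristoforovSmirnov2021, §2 Definition 3 and Lemma 4 (p. 4)] -/
theorem khsLemma4_holds : KhSLemma4 D :=
  khsLemma4_of_relinking (reLinking₃_holds D)

/-- `τ³ = 1`, as `τ³ − 1 = 0` (re-exported for the `ccwNbr` form). [folklore] -/
private theorem tau_cube' : tau ^ 3 - 1 = 0 := by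
  have hprim : IsPrimitiveRoot tau 3 := by
    have h := Complex.isPrimitiveRoot_exp 3 (by norm_num)
    unfold tau
    convert h using 2
    push_cast
    ring
  have h := hprim.geom_sum_eq_zero (by norm_num : 1 < 3)
  simp only [Finset.sum_range_succ, Finset.sum_range_zero, pow_zero, pow_one, zero_add] at h
  linear_combination (tau - 1) * h

/-- the observable at the mid-edge between `v` and a neighbouring face `w` (symmetric bookkeeping for the `ccwNbr` statement):
`F(v, w) := F` at the side `i` of `v` with `oppFace v i = w` (junk `0` if `w` is not a neighbour). [cite: KhristoforovSmirnov2021, §2 Definition 3 (p. 4)] -/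
noncomputable def FobsAt (v w : HexVertex) : ℂ :=
  if h : ∃ i : Fin 3, oppFace v i = w then Fobs D v (Classical.choose h) else 0

/-- `FobsAt` at a neighbour is `Fobs` at the corresponding side. [folklore] [cite: KhristoforovSmirnov2021, §2 Definition 3 and Lemma 4 (p. 4)] -/
theorem fobsAt_oppFace (v : HexVertex) (i : Fin 3) : FobsAt D v (oppFace v i) = Fobs D v i := by
  unfold FobsAt
  have h : ∃ i' : Fin 3, oppFace v i' = oppFace v i := ⟨i, rfl⟩
  rw [dif_pos h, oppFace_injective' v (Classical.choose_spec h)]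

/-- ★ **Khristoforov–Smirnov's Lemma 4, `k = 3`, in the COUNTER-CLOCKWISE indexing of the tree's five-point theorems** (`ccwNbr`):
`Σ_{k : Fin 3} τ^k F(v, ccwNbr v k) = 0` at every vertex with three `H_G`-sides, for every 3-marked domain.
[cite: KhristoforovSmirnov2021, §2 Lemma 4 (p. 4)] -/
theorem khsLemma4_ccw (v : HexVertex) (hv : AllSides D v) :
    ∑ k : Fin 3, tau ^ (k : ℕ) * FobsAt D v (ccwNbr v k) = 0 := by
  have hopp := khsLemma4_holds D v hv
  rw [Fin.sum_univ_three] at hopp ⊢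
  simp only [ha_ccwNbr_eq_oppFace, fobsAt_oppFace]
  by_cases hup : v.2 = 0
  · simp only [hup, ↓reduceIte, Fin.val_zero, Fin.val_one, Fin.val_two, pow_zero, pow_one, one_mul] at hopp ⊢
    have e0 : ((0 : Fin 3) + 2) = 2 := by decide
    have e1 : ((1 : Fin 3) + 2) = 0 := by decide
    have e2 : ((2 : Fin 3) + 2) = 1 := by decide
    rw [e0, e1, e2]
    linear_combination tau * hopp - (Fobs D v 2) * tau_cube' 
  · simp only [hup, ↓reduceIte, Fin.val_zero, Fin.val_one, Fin.val_two, pow_zero, pow_one, one_mul] at hopp ⊢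
    exact hopp

end Lemma4

end Literature.Probability.Percolation.MarkedLoops
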